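import Literature.NumberTheory.Irrationality.LaiLupuSprang2025.PoleExpansion
import HarnessLib

/-!
# Lai–Lupu–Sprang 2025, Lemmas 6.2 and 6.3: the expansion of `R_n(t/p)` at `t = ∞`,
# `v_p(Σ_j R̃_n(j/p)) = (p+s)(n+1) + s·v_p(n!) − M₀ − 2 − N` and `v_p(S_n)` for `n = n(N)` — PROVED

Topic `Literature/NumberTheory/Irrationality/LaiLupuSprang2025`.  Source: L. Lai, C. Lupu, J. Sprang, *On the irrationality
of certain `p`-adic zeta values*, Res. Math. Sci. 12 (2025) = arXiv:2505.23088 [LaiLupuSprang2025], §6: the definition of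
`n(N)` and `I` ((def:n(N)), (def:I), «`(n(N)+1)(p−1+s) − M₀ = p^N(p−1)+1`»), Lemma 6.2 with (P(t)), (Q(t)), (eq:congP),
(eq:vphk), (eq:cong_hk1)–(eq:cong_hk2), and Lemma 6.3 (held text `paper:arxiv-2505.23088`, chunks p0009–p0010, read on the
page).  PROOF FILE (definitions with bodies + theorems; no named fact, net debt 0): sixth file of the discharge of
`PAdicZetaValues.laiLupuSprang2025_theorem11`, on `RationalFunction.lean` (`Rn`, `coeffR`, `rho_one_eq_zero`),
`LinearForms.lean` (`Rtil`, `Sj`, `Sn`), `ExpansionLemmas.lean` and `PoleExpansion.lean` (Lemma 6.1).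

## Source, as printed ([LaiLupuSprang2025, Lemma 6.2, Lemma 6.3])

**Lemma 6.2.** «For any `n = n(N) ∈ I`, we have `v_p(Σ_{j=1}^{p−1} R̃_n(j/p)) = (p+s)(n+1) + s·v_p(n!) − M₀ − 2 − N`.»
*Proof.* «`R_n(t/p) = p^{(p+s)(n+1)−M₀−1}·n!^s·t^{−((p−1+s)(n+1)−M₀)} × ∏_{ν=1}^{p−1}∏_{m<n}(t + pm + ν) × ∏_{m≤n}(1 + pm/t)^{−(p−1+s)}`.
Let us denote by `P(t) ∈ ℤ_p[t]` the polynomial in (P(t)) and by `Q(t) ∈ ℤ_p⟦p·t^{−1}⟧` the power series in (Q(t)).  Note that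
`P(t)` is of degree `(p−1)n` and `P(t) ≡ (t^{p−1} − 1)^n (mod pℤ_p[t])` [(eq:congP)].  Let us write
`R_n(t/p) = p^{(p+s)(n+1)−M₀−1}n!^s·Σ_{k} h_k t^{−k}`.  Since `Q(t) ∈ ℤ_p⟦p·t^{−1}⟧`, we get `v_p(h_k) ≥ max{0, k−(p−1+s)(n+1)+M₀}`
[(eq:vphk)] … `h_k ≡ 0 (mod p)` for `0 ≤ k ≤ p^N(p−1)+1` with `k ≢ 1 (mod p−1)`, `h_{p^N(p−1)+1} ≡ 1 (mod p)` … We can now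
compute `R̃_n(t/p) = p^{(p+s)(n+1)−M₀−2}n!^s·Σ_k (h_k/(1−k)) t^{−(k−1)}` … `v_p(h_k/(1−k)) > −N` for `k ≠ p^N(p−1)+1`, `= −N` for
`k = p^N(p−1)+1` … This shows `v_p(Σ_j R̃_n(j/p)) = (p+s)(n+1) − M₀ − 2 + s·v_p(n!) − N`.»
**Lemma 6.3.** «For `n = n(N) ∈ I` … `v_p(S_n) = (p+s)(n+1) − M₀ − 2 + s·v_p(n!) − N`.  In particular `S_n ≠ 0` …»  *Proof.*
«`S_{j/p} = −𝓛_1(R_n(t+j/p)) − R̃_n(j/p)` … by Lemma 6.1 and Lemma 6.2, `v_p(Σ_j R̃_n(j/p)) < v_p(𝓛_1(R_n(t+j/p)))` …»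

## What is formalised (all PROVED; `p` prime, `s ≥ 1`, degree condition of Lemma 4.1 with room `+2`)

* The model at infinity in the variable `W = 1/t`: `GinfProd`/`GinfSum` (`= R_n(1/(pW))` off `W = 0`, `GinfProd_eq_Rn`,
  `GinfSum_eq_Rn`), the order `Kinf = (n+1)(p−1+s) − M₀ − (p−1)n` of `R_n(t/p)` at `∞`, and the formal expansion
  `infSer := pTaylor 1 GinfSum 0 = Σ_k Σ_i r_{i,k}p^i X^i (invLin (pk) 1)^i` (`infSer_eq_sum`) `= p^{E'}n!^s·X^{Kinf}·P·Q`
  (`infSer_eq_prod`; `P = infP = ∏(1 + (pm+ν)X)` of degree `(p−1)n`, `Q = infQ = ∏_l (invLin (pl) 1)^{p−1+s} ∈ ℤ_p⟦pX⟧`), i.e.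
  **`Σ_k h_k X^k = hinf := X^{Kinf}·P·Q`**; (eq:congP) as `psOrdGe_infP_sub` (`P ≡ (1 − X^{p−1})^n`) and
  `psOrdGe_hinf_sub` (`hinf ≡ X^{Kinf}(1−X^{p−1})^n (mod p)`); (eq:vphk) as `padicOrdGe_coeff_hinf`.
* The primitive `infPrim` (`Σ_k r_{1,k} logSer (pk) 1 + Σ_{i≥2} (r_{i,k}p^{i−1}/(1−i)) X^{i−1}(invLin (pk) 1)^{i−1}`) with
  **`X²·(infPrim)′ = −p^{−1}·infSer`** (`X_sq_mul_derivative_infPrim`, uses `ρ_1 = 0`) and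
  `coeff_infPrim_mul` (`K·[X^K]infPrim = −p^{E'−1}n!^s·h_{K+1}`, the «`h_k/(1−k)`»).
* **The analytic bridge** `hasSum_infPrim`: `R̃_n(j/p) = Rtil p s n j 0 = Σ_K [X^K]infPrim · j^{−K}` in `ℚ_p`.
* Along `n = n(N)` (hypothesis `(n+1)(p−1+s) = p^N(p−1) + 1 + M₀`, `N ≥ 1`): `coeff_oneSubXPow_*` (the coefficients of
  `(1 − X^{p−1})^n`), `norm_coeff_hinf_kstar` (`h_{p^N(p−1)+1}` is a unit), `padicValNat_le_of_ne_kstar` (the case analysis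
  «`v_p(h_k/(1−k)) > −N` for `k ≠ p^N(p−1)+1`»), **Lemma 6.2** `norm_sum_Rtil_zero`
  (`‖Σ_{j=1}^{p−1} R̃_n(j/p)‖_p = p^{N}·p^{−(E'−1 + s·v_p(n!))}`), and **Lemma 6.3** `norm_Sn` (`‖S_n‖_p` = the same) with
  `Sn_ne_zero`.

Cell zeta5-irr / pub-zeta5 (HONEST FRAMING: systematic search; no irrationality claim unless kernel-certified): `p`-adic
bookkeeping of a PUBLISHED proof; nothing here bears on `ζ(5) ∈ ℝ`.
-/

noncomputable section

open Finset Filter Topology PowerSeries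
open scoped Nat
open Literature.NumberTheory.Transcendental
open Literature.NumberTheory.LocalFields
open Literature.Analysis.Calculus (divDeriv divDeriv_congr)

namespace Literature.NumberTheory.Irrationality.LaiLupuSprang2025

/-! ## §1. The model at infinity `W ↦ R_n(1/(pW))` and its two shapes -/

/-- `Kinf = (n+1)(p−1+s) − M₀ − (p−1)n`: the order of `R_n(t/p)` at `t = ∞` (the exponent `(p−1+s)(n+1) − M₀` of (6.6)
minus `deg ∏(t+pm+ν) = (p−1)n`). [cite: LaiLupuSprang2025, Lemma 6.2 (first display)] -/
def Kinf (p s n : ℕ) : ℕ := (n + 1) * (p - 1 + s) - M0 p s - (p - 1) * n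

/-- The product-form model at infinity: `p^{E'}n!^s·W^{Kinf}·∏_{ν,m}(1 + (pm+ν)W)·∏_l (1 + plW)^{−(p−1+s)}` (`W = 1/t`).
[cite: LaiLupuSprang2025, Lemma 6.2 (first display, (P(t)), (Q(t)))] -/
def GinfProd (p s n : ℕ) (W : ℚ) : ℚ :=
  (p : ℚ) ^ Eexp p s n * (n ! : ℚ) ^ s * (W + 0) ^ Kinf p s n *
    (∏ ν ∈ Ico 1 p, ∏ m ∈ range n, (((p * m + ν : ℕ) : ℚ) * W + 1)) *
      ∏ l ∈ range (n + 1), ((1 + ((p * l : ℕ) : ℚ) * W)⁻¹) ^ (p - 1 + s)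

/-- The partial-fraction model at infinity: `Σ_k Σ_i r_{i,k} p^i W^i (1 + pkW)^{−i}` (`(1/(pW) + k)^{−i} = p^iW^i(1+pkW)^{−i}`).
[cite: LaiLupuSprang2025, Definition 3.2 (def:r_ik) and Lemma 6.2] -/
def GinfSum (p s n : ℕ) (W : ℚ) : ℚ :=
  ∑ k ∈ range (n + 1), ∑ i ∈ Icc 1 (p - 1 + s),
    coeffR p s n i k * (p : ℚ) ^ i * ((W + 0) ^ i * ((1 + ((p * k : ℕ) : ℚ) * W)⁻¹) ^ i)

/-- Exponent bookkeeping: `(n+1)(p−1+s) = M₀ + (p−1)n + Kinf` and `E' = pn + Kinf` under the degree condition.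
[cite: LaiLupuSprang2025, Lemma 6.2 (first display)] -/
theorem Kinf_spec {p s n : ℕ} (hp : 1 ≤ p) (hdeg : M0 p s + (p - 1) * n ≤ (p - 1 + s) * (n + 1)) :
    (n + 1) * (p - 1 + s) = M0 p s + (p - 1) * n + Kinf p s n ∧ Eexp p s n = p * n + Kinf p s n := by
  have hc : (p - 1 + s) * (n + 1) = (n + 1) * (p - 1 + s) := Nat.mul_comm _ _
  obtain ⟨q, rfl⟩ : ∃ q, p = q + 1 := ⟨p - 1, by omega⟩
  have hq : q + 1 - 1 = q := by omega
  rw [hq] at hdeg hc ⊢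
  unfold Kinf Eexp
  rw [hq]
  have : (q + 1) * n = q * n + n := by ring
  omega

/-- `GinfProd W = R_n(1/(pW))` for `W ≠ 0` off the poles. [cite: LaiLupuSprang2025, Lemma 6.2 (first display)] -/
theorem GinfProd_eq_Rn {p : ℕ} (hp : 1 ≤ p) (s n : ℕ) (hdeg : M0 p s + (p - 1) * n ≤ (p - 1 + s) * (n + 1)) {W : ℚ}
    (hW : W ≠ 0) (hW' : ∀ l ∈ range (n + 1), 1 + ((p * l : ℕ) : ℚ) * W ≠ 0) :
    GinfProd p s n W = Rn p s n (W⁻¹ / p) := by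
  have hp0 : (p : ℚ) ≠ 0 := by exact_mod_cast (show p ≠ 0 by omega)
  have hpW : (p : ℚ) * W ≠ 0 := mul_ne_zero hp0 hW
  obtain ⟨hK, hEK⟩ := Kinf_spec hp hdeg
  unfold GinfProd Rn
  have h1 : (W⁻¹ / p) ^ M0 p s = (((p : ℚ) * W) ^ M0 p s)⁻¹ := by
    rw [← inv_pow]; congr 1; field_simp
  have h2 : ∏ j ∈ Ico 1 p, ∏ m ∈ range n, (W⁻¹ / p + ((j : ℚ) / p + m)) =
      (∏ ν ∈ Ico 1 p, ∏ m ∈ range n, (((p * m + ν : ℕ) : ℚ) * W + 1)) / ((p : ℚ) * W) ^ ((p - 1) * n) := by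
    have hfac : ∀ ν ∈ Ico 1 p, ∏ m ∈ range n, (W⁻¹ / p + ((ν : ℚ) / p + m)) =
        (∏ m ∈ range n, (((p * m + ν : ℕ) : ℚ) * W + 1)) / ((p : ℚ) * W) ^ n := by
      intro ν _
      rw [eq_div_iff (pow_ne_zero _ hpW), ← card_range n, ← prod_const, card_range, ← prod_mul_distrib]
      refine prod_congr rfl fun m _ => ?_
      push_cast
      field_simp
      ring
    rw [prod_congr rfl hfac, prod_div_distrib, prod_const, Nat.card_Ico, ← pow_mul, mul_comm n]
  have h3 : (∏ m ∈ range (n + 1), (W⁻¹ / p + m)) ^ (p - 1 + s) =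
      (∏ l ∈ range (n + 1), (1 + ((p * l : ℕ) : ℚ) * W)) ^ (p - 1 + s) / ((p : ℚ) * W) ^ ((n + 1) * (p - 1 + s)) := by
    have hfac : ∏ m ∈ range (n + 1), (W⁻¹ / p + m) =
        (∏ l ∈ range (n + 1), (1 + ((p * l : ℕ) : ℚ) * W)) / ((p : ℚ) * W) ^ (n + 1) := by
      rw [eq_div_iff (pow_ne_zero _ hpW), ← card_range (n + 1), ← prod_const, card_range, ← prod_mul_distrib]
      refine prod_congr rfl fun l _ => ?_
      push_cast
      field_simp
    rw [hfac, div_pow, ← pow_mul]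
  have hprod : (∏ l ∈ range (n + 1), (1 + ((p * l : ℕ) : ℚ) * W)) ≠ 0 := prod_ne_zero_iff.2 hW'
  set e := p - 1 + s with he
  clear_value e
  rw [h1, h2, h3, add_zero, hEK, hK, pow_add, pow_add, pow_add]
  simp only [inv_pow, prod_inv_distrib, prod_pow]
  field_simp
  ring

/-- `GinfSum W = R_n(1/(pW))` for `W ≠ 0` off the poles ((def:r_ik)). [cite: LaiLupuSprang2025, Definition 3.2 (def:r_ik), Lemma 6.2] -/
theorem GinfSum_eq_Rn {p : ℕ} (hp : 1 ≤ p) (s n : ℕ) (hdeg : M0 p s + (p - 1) * n < (p - 1 + s) * (n + 1)) {W : ℚ}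
    (hW : W ≠ 0) (hW' : ∀ l ∈ range (n + 1), 1 + ((p * l : ℕ) : ℚ) * W ≠ 0) :
    GinfSum p s n W = Rn p s n (W⁻¹ / p) := by
  have hp0 : (p : ℚ) ≠ 0 := by exact_mod_cast (show p ≠ 0 by omega)
  have ht : ∀ l ∈ range (n + 1), W⁻¹ / p + l ≠ 0 := by
    intro l hl h
    apply hW' l hl
    have : 1 + ((p * l : ℕ) : ℚ) * W = (p : ℚ) * W * (W⁻¹ / p + l) := by push_cast; field_simp
    rw [this, h, mul_zero]
  rw [Rn_eq_sum_coeffR hp s n hdeg ht, GinfSum]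
  refine sum_congr rfl fun k hk => sum_congr rfl fun i _ => ?_
  rw [add_zero, mul_assoc]
  congr 1
  have : W⁻¹ / p + k = (1 + ((p * k : ℕ) : ℚ) * W) / ((p : ℚ) * W) := by push_cast; field_simp
  rw [this, div_pow, inv_div, mul_pow, inv_pow, div_eq_mul_inv]
  ring

/-- No poles near `W = 0`: `1 + plW ≠ 0` for `|W| < 1/(pn+1)`. [cite: LaiLupuSprang2025, Lemma 6.2 ("Q(t) ∈ ℤ_p⟦p·t^{−1}⟧")] -/
theorem eventually_one_add_mul_ne_zero (p n : ℕ) :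
    ∀ᶠ W : ℚ in 𝓝 (0 : ℚ), ∀ l ∈ range (n + 1), 1 + ((p * l : ℕ) : ℚ) * W ≠ 0 := by
  rw [Metric.eventually_nhds_iff]
  refine ⟨1 / ((p : ℝ) * n + 1), by positivity, fun W hW l hl => ?_⟩
  rw [Rat.dist_eq, Rat.cast_zero, sub_zero] at hW
  have hl' : (l : ℝ) ≤ n := by exact_mod_cast (by have := mem_range.1 hl; omega : l ≤ n)
  intro h
  have hW1 : ((((p * l : ℕ) : ℚ) * W : ℚ) : ℝ) = -1 := by
    have : ((p * l : ℕ) : ℚ) * W = -1 := by linear_combination h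
    exact_mod_cast this
  have hpn : (0 : ℝ) ≤ (p : ℝ) * n := by positivity
  have habs : |((((p * l : ℕ) : ℚ) * W : ℚ) : ℝ)| < 1 := by
    push_cast
    rw [abs_mul, abs_of_nonneg (by positivity : (0 : ℝ) ≤ (p : ℝ) * l)]
    have hWn : 0 ≤ |(W : ℝ)| := abs_nonneg _
    calc (p : ℝ) * l * |(W : ℝ)| ≤ ((p : ℝ) * n + 1) * |(W : ℝ)| := by
          apply mul_le_mul_of_nonneg_right _ hWn
          nlinarith [(Nat.cast_nonneg p : (0 : ℝ) ≤ p)]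
      _ < ((p : ℝ) * n + 1) * (1 / ((p : ℝ) * n + 1)) := by gcongr
      _ = 1 := by field_simp
  rw [hW1, abs_neg, abs_one] at habs
  exact lt_irrefl _ habs

/-- `GinfSum = GinfProd` near `W = 0` (both vanish at `W = 0` since `Kinf ≥ 1`, `i ≥ 1`).
[cite: LaiLupuSprang2025, Lemma 6.2 (first display) with (def:r_ik)] -/
theorem GinfSum_eventuallyEq_GinfProd {p : ℕ} (hp : 1 ≤ p) (s n : ℕ)
    (hdeg : M0 p s + (p - 1) * n < (p - 1 + s) * (n + 1)) :
    GinfSum p s n =ᶠ[𝓝 (0 : ℚ)] GinfProd p s n := by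
  filter_upwards [eventually_one_add_mul_ne_zero p n] with W hW'
  by_cases hW : W = 0
  · subst hW
    have hK : Kinf p s n ≠ 0 := by
      have := (Kinf_spec hp hdeg.le).1
      have hc : (p - 1 + s) * (n + 1) = (n + 1) * (p - 1 + s) := Nat.mul_comm _ _
      omega
    simp only [GinfSum, GinfProd, add_zero, zero_pow hK, mul_zero, zero_mul]
    refine sum_eq_zero fun k _ => sum_eq_zero fun i hi => ?_
    rw [zero_pow (by have := (mem_Icc.1 hi).1; omega), zero_mul, mul_zero]
  · rw [GinfSum_eq_Rn hp s n hdeg hW hW', GinfProd_eq_Rn hp s n hdeg.le hW hW']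

/-! ## §2. `Σ_k h_k X^k`: the expansion of `R_n(t/p)` in `X = 1/t`, its product form, (eq:congP) and (eq:vphk) -/

/-- **`infSer`**: the formal expansion of `R_n(1/(pX))` at `X = 0` (the tree's `pTaylor` with trivial scaling `p := 1`).
[cite: LaiLupuSprang2025, Lemma 6.2 ("Let us write R_n(t/p) = p^{…} n!^s Σ_k h_k t^{−k}")] -/
def infSer (p s n : ℕ) : ℚ⟦X⟧ := pTaylor 1 (GinfSum p s n) 0

/-- `invLin 0 w = C w⁻¹`. [cite: LaiLupuSprang2025, Lemma 6.2 (the factor m = 0 of (Q(t)) is 1)] -/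
theorem invLin_zero_left (w : ℚ) : invLin 0 w = C w⁻¹ := by
  ext j
  rw [coeff_invLin, coeff_C]
  rcases j with _ | j
  · simp
  · rw [if_neg (Nat.succ_ne_zero j), neg_zero, zero_pow (Nat.succ_ne_zero j), zero_div]

/-- `(1 + cW)^{−1}` is smooth at `W = 0`. [cite: LaiLupuSprang2025, Lemma 6.2 ((Q(t)) converges near t = ∞)] -/
theorem contDiffAt_inv_one_add_mul (c : ℚ) {N : WithTop ℕ∞} : ContDiffAt ℚ N (fun W : ℚ => (1 + c * W)⁻¹) 0 :=
  (contDiffAt_const.add (contDiffAt_const.mul contDiffAt_id)).inv (by simp)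

/-- **`pTaylor` of `(1 + cW)^{−1}` at `0` is `invLin c 1 = Σ (−c)^j X^j`.** [cite: LaiLupuSprang2025, Lemma 6.2 ((Q(t)): (1 + pm/t)^{−1} ∈ ℤ_p⟦p·t^{−1}⟧)] -/
theorem pTaylor_inv_one_add_mul (c : ℚ) : pTaylor 1 (fun W : ℚ => (1 + c * W)⁻¹) 0 = invLin c 1 := by
  by_cases hc : c = 0
  · subst hc
    simp only [zero_mul, add_zero, inv_one]
    rw [pTaylor_const, invLin_zero_left, inv_one, map_one]
  · have e : (fun W : ℚ => (1 + c * W)⁻¹) = fun W => c⁻¹ * (W + c⁻¹)⁻¹ := by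
      funext W
      rw [← mul_inv, mul_add, mul_inv_cancel₀ hc, add_comm, mul_comm]
    have h0 : (0 : ℚ) + c⁻¹ ≠ 0 := by simpa using inv_ne_zero hc
    rw [e, pTaylor_const_mul, pTaylor_inv_add_const 1 h0, Nat.cast_one]
    ext j
    rw [coeff_C_mul, coeff_invLin, coeff_invLin, zero_add, one_pow, div_one, inv_pow, div_inv_eq_mul, neg_pow,
      neg_pow c, one_pow, mul_one, pow_succ]
    field_simp

/-- `pTaylor 1 (W ↦ W + 0) 0 = X`. [cite: LaiLupuSprang2025, Lemma 6.2 (the variable 1/t)] -/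
theorem pTaylor_id_zero : pTaylor 1 (fun W : ℚ => W + 0) 0 = X := by
  rw [pTaylor_add_const]; simp

/-- The polynomial `P = ∏_{ν,m}(1 + (pm+ν)X)` of (P(t)) in the variable `X = 1/t` (`∏(t+pm+ν) = t^{(p−1)n}·P(1/t)`).
[cite: LaiLupuSprang2025, Lemma 6.2 (P(t))] -/
def infP (p n : ℕ) : ℚ⟦X⟧ := ∏ ν ∈ Ico 1 p, ∏ m ∈ range n, (1 + C ((p * m + ν : ℕ) : ℚ) * X)

/-- The series `Q = ∏_{m≤n}(1 + pmX)^{−(p−1+s)} ∈ ℤ_p⟦pX⟧` of (Q(t)) in `X = 1/t`. [cite: LaiLupuSprang2025, Lemma 6.2 (Q(t))] -/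
def infQ (p s n : ℕ) : ℚ⟦X⟧ := ∏ l ∈ range (n + 1), invLin ((p * l : ℕ) : ℚ) 1 ^ (p - 1 + s)

/-- **`Σ_k h_k X^k`** `:= X^{Kinf}·P·Q`. [cite: LaiLupuSprang2025, Lemma 6.2 ("R_n(t/p) = p^{(p+s)(n+1)−M_0−1} n!^s Σ_k h_k t^{−k}")] -/
def hinf (p s n : ℕ) : ℚ⟦X⟧ := X ^ Kinf p s n * infP p n * infQ p s n

/-- **The product form at infinity**: `infSer = p^{E'}·n!^s · X^{Kinf}·P·Q = p^{E'} n!^s · Σ_k h_k X^k`.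
[cite: LaiLupuSprang2025, Lemma 6.2 (first display, (P(t)), (Q(t)))] -/
theorem infSer_eq_hinf {p : ℕ} (hp : 1 ≤ p) (s n : ℕ) (hdeg : M0 p s + (p - 1) * n < (p - 1 + s) * (n + 1)) :
    infSer p s n = C ((p : ℚ) ^ Eexp p s n * (n ! : ℚ) ^ s) * hinf p s n := by
  have h1 : ContDiffAt ℚ (⊤ : ℕ∞) (fun _ : ℚ => (p : ℚ) ^ Eexp p s n * (n ! : ℚ) ^ s) (0 : ℚ) := contDiffAt_const
  have h2 : ContDiffAt ℚ (⊤ : ℕ∞) (fun W : ℚ => (W + 0) ^ Kinf p s n) (0 : ℚ) := by fun_prop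
  have h3 : ContDiffAt ℚ (⊤ : ℕ∞) (fun W : ℚ => ∏ ν ∈ Ico 1 p, ∏ m ∈ range n, (((p * m + ν : ℕ) : ℚ) * W + 1)) (0 : ℚ) :=
    contDiffAt_prod fun ν _ => contDiffAt_prod fun m _ => by fun_prop
  have h4l : ∀ l ∈ range (n + 1),
      ContDiffAt ℚ (⊤ : ℕ∞) (fun W : ℚ => ((1 + ((p * l : ℕ) : ℚ) * W)⁻¹) ^ (p - 1 + s)) (0 : ℚ) :=
    fun l _ => (contDiffAt_inv_one_add_mul _).pow _
  have h4 : ContDiffAt ℚ (⊤ : ℕ∞)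
      (fun W : ℚ => ∏ l ∈ range (n + 1), ((1 + ((p * l : ℕ) : ℚ) * W)⁻¹) ^ (p - 1 + s)) (0 : ℚ) := contDiffAt_prod h4l
  rw [infSer, pTaylor_congr 1 (GinfSum_eventuallyEq_GinfProd hp s n hdeg)]
  have e : GinfProd p s n = fun W => ((((fun _ : ℚ => (p : ℚ) ^ Eexp p s n * (n ! : ℚ) ^ s) W *
      (fun W : ℚ => (W + 0) ^ Kinf p s n) W) *
      (fun W : ℚ => ∏ ν ∈ Ico 1 p, ∏ m ∈ range n, (((p * m + ν : ℕ) : ℚ) * W + 1)) W) *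
      (fun W : ℚ => ∏ l ∈ range (n + 1), ((1 + ((p * l : ℕ) : ℚ) * W)⁻¹) ^ (p - 1 + s)) W) := by
    funext W; rfl
  have hb2 : pTaylor 1 (fun W : ℚ => (W + 0) ^ Kinf p s n) 0 = X ^ Kinf p s n := by
    rw [pTaylor_fun_pow (by fun_prop : ContDiffAt ℚ (⊤ : ℕ∞) (fun W : ℚ => W + 0) (0 : ℚ)), pTaylor_id_zero]
  have hb3 : pTaylor 1 (fun W : ℚ => ∏ ν ∈ Ico 1 p, ∏ m ∈ range n, (((p * m + ν : ℕ) : ℚ) * W + 1)) 0 = infP p n := by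
    rw [pTaylor_fun_prod _ fun ν _ => contDiffAt_prod fun m _ => (by fun_prop :
      ContDiffAt ℚ (⊤ : ℕ∞) (fun W : ℚ => ((p * m + ν : ℕ) : ℚ) * W + 1) (0 : ℚ)), infP]
    refine prod_congr rfl fun ν _ => ?_
    rw [pTaylor_fun_prod _ fun m _ => (by fun_prop :
      ContDiffAt ℚ (⊤ : ℕ∞) (fun W : ℚ => ((p * m + ν : ℕ) : ℚ) * W + 1) (0 : ℚ))]
    refine prod_congr rfl fun m _ => ?_
    rw [pTaylor_affine, mul_zero, zero_add, map_one, Nat.cast_one, mul_one, add_comm]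
  have hb4 : pTaylor 1 (fun W : ℚ => ∏ l ∈ range (n + 1), ((1 + ((p * l : ℕ) : ℚ) * W)⁻¹) ^ (p - 1 + s)) 0 =
      infQ p s n := by
    rw [pTaylor_fun_prod _ h4l, infQ]
    refine prod_congr rfl fun l _ => ?_
    rw [pTaylor_fun_pow (contDiffAt_inv_one_add_mul _), pTaylor_inv_one_add_mul]
  rw [e, pTaylor_fun_mul ((h1.mul h2).mul h3) h4, pTaylor_fun_mul (h1.mul h2) h3, pTaylor_fun_mul h1 h2,
    pTaylor_const, hb2, hb3, hb4, hinf]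
  ring

/-- **The partial-fraction form at infinity**: `infSer = Σ_k Σ_i r_{i,k} p^i X^i (invLin (pk) 1)^i`.
[cite: LaiLupuSprang2025, Definition 3.2 (def:r_ik) and Lemma 6.2] -/
theorem infSer_eq_sum (p s n : ℕ) :
    infSer p s n = ∑ k ∈ range (n + 1), ∑ i ∈ Icc 1 (p - 1 + s),
      C (coeffR p s n i k * (p : ℚ) ^ i) * (X ^ i * invLin ((p * k : ℕ) : ℚ) 1 ^ i) := by
  have hsm : ∀ (k i : ℕ), ContDiffAt ℚ (⊤ : ℕ∞)
      (fun W : ℚ => (W + 0) ^ i * ((1 + ((p * k : ℕ) : ℚ) * W)⁻¹) ^ i) (0 : ℚ) :=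
    fun k i => (by fun_prop : ContDiffAt ℚ (⊤ : ℕ∞) (fun W : ℚ => (W + 0) ^ i) (0 : ℚ)).mul
      ((contDiffAt_inv_one_add_mul _).pow _)
  rw [infSer, GinfSum.eq_def p s n |> fun h => (funext h : GinfSum p s n = _), pTaylor_finset_sum 1 _ fun k _ => ?_]
  · refine sum_congr rfl fun k _ => ?_
    rw [pTaylor_finset_sum 1 _ fun i _ => ?_]
    · refine sum_congr rfl fun i _ => ?_
      rw [pTaylor_const_mul,
        pTaylor_fun_mul (by fun_prop : ContDiffAt ℚ (⊤ : ℕ∞) (fun W : ℚ => (W + 0) ^ i) (0 : ℚ))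
          ((contDiffAt_inv_one_add_mul _).pow _),
        pTaylor_fun_pow (by fun_prop : ContDiffAt ℚ (⊤ : ℕ∞) (fun W : ℚ => W + 0) (0 : ℚ)), pTaylor_id_zero,
        pTaylor_fun_pow (contDiffAt_inv_one_add_mul _), pTaylor_inv_one_add_mul]
    · exact contDiffAt_const.mul (hsm k i)
  · exact ContDiffAt.sum fun i _ => contDiffAt_const.mul (hsm k i)

/-! ### Orders and degrees: `P ∈ ℤ_p[X]` of degree `(p−1)n`, `Q ∈ ℤ_p⟦pX⟧`, (eq:congP), (eq:vphk) -/

/-- A factor `1 + cX` with `p`-integral `c` is `p`-integral. [cite: LaiLupuSprang2025, Lemma 6.2 ("P(t) ∈ ℤ_p[t]")] -/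
theorem psOrdGe_one_add_C_mul_X {p : ℕ} [Fact p.Prime] {c : ℚ} (hc : PadicOrdGe p 0 c) :
    PSOrdGe p 0 (1 + C c * X : ℚ⟦X⟧) := fun j => by
  rw [map_add, coeff_one, coeff_C_mul, coeff_X]
  rcases j with _ | _ | j
  · simpa using PadicOrdGe.of_nat (p := p) 1
  · simpa using hc
  · simp only [add_assoc]
    norm_num
    exact PadicOrdGe.zero _

/-- The factors of `P`. [cite: LaiLupuSprang2025, Lemma 6.2 ("P(t) ∈ ℤ_p[t]")] -/
theorem psOrdGe_infP_factor (p m ν : ℕ) [Fact p.Prime] : PSOrdGe p 0 (1 + C ((p * m + ν : ℕ) : ℚ) * X : ℚ⟦X⟧) :=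
  psOrdGe_one_add_C_mul_X (by exact_mod_cast PadicOrdGe.of_nat (p := p) (p * m + ν))

/-- `P` has `p`-integral coefficients. [cite: LaiLupuSprang2025, Lemma 6.2 ("P(t) ∈ ℤ_p[t]")] -/
theorem psOrdGe_infP (p n : ℕ) [Fact p.Prime] : PSOrdGe p 0 (infP p n) :=
  PSOrdGe.prod _ fun ν _ => PSOrdGe.prod _ fun m _ => psOrdGe_infP_factor p m ν

/-- Degree of a product: factors of degree `≤ d_i` give a product of degree `≤ Σ d_i`.
[cite: LaiLupuSprang2025, Lemma 6.2 ("P(t) is of degree (p−1)n")] -/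
theorem coeff_prod_eq_zero_of_degree {ι : Type*} (S : Finset ι) {F : ι → ℚ⟦X⟧} (d : ι → ℕ)
    (h : ∀ i ∈ S, ∀ a, d i < a → coeff a (F i) = 0) : ∀ a, ∑ i ∈ S, d i < a → coeff a (∏ i ∈ S, F i) = 0 := by
  classical
  induction S using Finset.induction_on with
  | empty => intro a ha; rw [prod_empty, coeff_one, if_neg (by rw [sum_empty] at ha; omega)]
  | insert b S hb ih =>
    intro a ha
    rw [prod_insert hb]
    rw [sum_insert hb] at ha
    exact coeff_mul_eq_zero_of_lt (h b (mem_insert_self b S)) (ih fun i hi => h i (mem_insert_of_mem hi)) a ha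

/-- `deg P ≤ (p−1)n`. [cite: LaiLupuSprang2025, Lemma 6.2 ("P(t) is of degree (p−1)n")] -/
theorem coeff_infP_eq_zero (p n : ℕ) : ∀ a, (p - 1) * n < a → coeff a (infP p n) = 0 := by
  intro a ha
  have hlin : ∀ c : ℚ, ∀ b, 1 < b → coeff b (1 + C c * X : ℚ⟦X⟧) = 0 := fun c b hb => by
    rw [map_add, coeff_one, coeff_C_mul, coeff_X, if_neg (by omega), if_neg (by omega), mul_zero, add_zero]
  have hinner : ∀ ν ∈ Ico 1 p, ∀ b, n < b → coeff b (∏ m ∈ range n, (1 + C ((p * m + ν : ℕ) : ℚ) * X)) = 0 := by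
    intro ν _ b hb
    refine coeff_prod_eq_zero_of_degree (range n) (fun _ => 1) (fun m _ => hlin _) b ?_
    simpa using hb
  refine coeff_prod_eq_zero_of_degree (Ico 1 p) (fun _ => n) hinner a ?_
  simpa [mul_comm] using ha

/-- `Q ∈ ℤ_p⟦pX⟧`. [cite: LaiLupuSprang2025, Lemma 6.2 ("Q(t) ∈ ℤ_p⟦p·t^{−1}⟧")] -/
theorem psOrdGeS_infQ (p s n : ℕ) [Fact p.Prime] : PSOrdGeS p 0 (infQ p s n) :=
  PSOrdGeS.prod _ fun l _ => (psOrdGeS_invLin_one (by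
    have := (padicOrdGe_one_natCast p).mul (PadicOrdGe.of_nat (p := p) l)
    push_cast; simpa using this)).pow _

/-- `Q ≡ 1 (mod p)`: `Q − 1 ∈ pℤ_p⟦X⟧`. [cite: LaiLupuSprang2025, Lemma 6.2 ("Q(t) ∈ ℤ_p⟦p·t^{−1}⟧")] -/
theorem psOrdGe_infQ_sub_one (p s n : ℕ) [Fact p.Prime] : PSOrdGe p 1 (infQ p s n - 1) := fun j => by
  rcases j with _ | j
  · rw [map_sub, coeff_zero_eq_constantCoeff_apply, coeff_zero_eq_constantCoeff_apply, infQ, map_prod]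
    simp only [map_pow, constantCoeff_invLin, inv_one, one_pow, prod_const_one, map_one, sub_self]
    exact PadicOrdGe.zero 1
  · rw [map_sub, coeff_one, if_neg (Nat.succ_ne_zero j), sub_zero]
    exact ((psOrdGeS_infQ p s n) (j + 1)).mono (by push_cast; omega)

/-- **(eq:congP): `P ≡ (1 − X^{p−1})^n (mod p)`** — each block `∏_{ν=1}^{p−1}(1 + (pm+ν)X) ≡ ∏_ν(1 + νX) ≡ 1 − X^{p−1}`.
[cite: LaiLupuSprang2025, Lemma 6.2 (eq:congP) ("P(t) ≡ (t^{p−1} − 1)^n mod pℤ_p[t]")] -/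
theorem psOrdGe_infP_sub (p n : ℕ) [hpr : Fact p.Prime] : PSOrdGe p 1 (infP p n - (1 - X ^ (p - 1)) ^ n) := by
  have hblock : ∀ m : ℕ, PSOrdGe p 1 ((∏ ν ∈ Ico 1 p, (1 + C ((p * m + ν : ℕ) : ℚ) * X)) - (1 - X ^ (p - 1))) := by
    intro m
    have h1 : PSOrdGe p 1 ((∏ ν ∈ Ico 1 p, (1 + C ((p * m + ν : ℕ) : ℚ) * X)) -
        ∏ ν ∈ Ico 1 p, (1 + C (ν : ℚ) * X)) := by
      refine PSOrdGe.prod_congr _ (fun ν _ => psOrdGe_infP_factor p m ν)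
        (fun ν _ => psOrdGe_one_add_C_mul_X (PadicOrdGe.of_nat (p := p) ν)) (fun ν _ => ?_)
      · have e : (1 + C ((p * m + ν : ℕ) : ℚ) * X : ℚ⟦X⟧) - (1 + C (ν : ℚ) * X) = C ((p : ℚ) * m) * X := by
          push_cast; rw [map_add, map_mul]; ring
        rw [e]
        simpa using (PSOrdGe.C ((padicOrdGe_one_natCast p).mul (PadicOrdGe.of_nat (p := p) m))).mul (PSOrdGe.X p)
    have := h1.add (psOrdGe_prod_one_add_mul_X_sub p)
    simpa using this
  rw [infP, Finset.prod_comm, show (1 - X ^ (p - 1) : ℚ⟦X⟧) ^ n = ∏ _m ∈ range n, (1 - X ^ (p - 1)) by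
    rw [prod_const, card_range]]
  exact PSOrdGe.prod_congr _ (fun m _ => PSOrdGe.prod _ fun ν _ => psOrdGe_infP_factor p m ν)
    (fun m _ => (PSOrdGe.one p).sub ((PSOrdGe.X p).pow _)) fun m _ => hblock m

/-- `Σ h_k X^k` has `p`-integral coefficients. [cite: LaiLupuSprang2025, Lemma 6.2 (eq:vphk) ("v_p(h_k) ≥ max{0, …}")] -/
theorem psOrdGe_hinf (p s n : ℕ) [Fact p.Prime] : PSOrdGe p 0 (hinf p s n) := by
  simpa [hinf] using (((PSOrdGe.X p).pow (Kinf p s n)).mul (psOrdGe_infP p n)).mul (psOrdGeS_infQ p s n).psOrdGe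

/-- **(eq:vphk): `v_p(h_k) ≥ k − ((p−1+s)(n+1) − M₀)`** (`= k − (Kinf + (p−1)n)`: `X^{Kinf}P` has degree `Kinf + (p−1)n`
and `Q ∈ ℤ_p⟦pX⟧`). [cite: LaiLupuSprang2025, Lemma 6.2 (eq:vphk)] -/
theorem padicOrdGe_coeff_hinf (p s n : ℕ) [Fact p.Prime] (k : ℕ) :
    PadicOrdGe p ((k : ℤ) - (Kinf p s n + (p - 1) * n : ℕ)) (coeff k (hinf p s n)) := by
  have hA : PSOrdGe p 0 (X ^ Kinf p s n * infP p n) := by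
    simpa using ((PSOrdGe.X p).pow (Kinf p s n)).mul (psOrdGe_infP p n)
  have hAdeg : ∀ a, Kinf p s n + (p - 1) * n < a → coeff a (X ^ Kinf p s n * infP p n) = 0 := fun a ha => by
    rw [coeff_X_pow_mul', if_pos (by omega), coeff_infP_eq_zero p n _ (by omega)]
  simpa [hinf] using padicOrdGe_coeff_mul_of_degree_le hA hAdeg (psOrdGeS_infQ p s n) k

/-- **`Σ h_k X^k ≡ X^{Kinf}(1 − X^{p−1})^n (mod p)`** ((eq:congP) with `Q ≡ 1`): the source of (eq:cong_hk1)–(eq:cong_hk2).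
[cite: LaiLupuSprang2025, Lemma 6.2 (eq:cong_hk1)–(eq:cong_hk2)] -/
theorem psOrdGe_hinf_sub (p s n : ℕ) [Fact p.Prime] :
    PSOrdGe p 1 (hinf p s n - X ^ Kinf p s n * (1 - X ^ (p - 1)) ^ n) := by
  have e : hinf p s n - X ^ Kinf p s n * (1 - X ^ (p - 1)) ^ n =
      X ^ Kinf p s n * ((infP p n - (1 - X ^ (p - 1)) ^ n) * infQ p s n +
        (1 - X ^ (p - 1)) ^ n * (infQ p s n - 1)) := by
    rw [hinf]; ring
  rw [e]
  have hX : PSOrdGe p 0 (X ^ Kinf p s n : ℚ⟦X⟧) := (PSOrdGe.X p).pow _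
  have hG : PSOrdGe p 0 ((1 - X ^ (p - 1)) ^ n : ℚ⟦X⟧) := ((PSOrdGe.one p).sub ((PSOrdGe.X p).pow _)).pow _
  simpa using hX.mul (((psOrdGe_infP_sub p n).mul (psOrdGeS_infQ p s n).psOrdGe).add
    (hG.mul (psOrdGe_infQ_sub_one p s n)))

/-! ## §3. The primitive at infinity: `R̃_n(t/p) = p^{E'−1} n!^s Σ_k (h_k/(1−k)) t^{−(k−1)}` -/

/-- **The formal primitive at infinity** (the expansion of `R̃_n(j/p)` in `X = 1/j`):
`Σ_k r_{1,k}·logSer (pk) 1 + Σ_k Σ_{i≥2} (r_{i,k}p^{i−1}/(1−i))·X^{i−1}(invLin (pk) 1)^{i−1}`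
(`log_p(1 + pk/j) = logSer(pk,1)(1/j)`, `(k + j/p)^{1−i} = p^{i−1} j^{−(i−1)} (1 + pk/j)^{−(i−1)}`).
[cite: LaiLupuSprang2025, §3 (3.3) and Lemma 6.2 ("R̃_n(t/p) = p^{…−2} n!^s Σ_k (h_k/(1−k)) t^{−(k−1)}")] -/
def infPrim (p s n : ℕ) : ℚ⟦X⟧ :=
  ∑ k ∈ range (n + 1), (C (coeffR p s n 1 k) * logSer ((p * k : ℕ) : ℚ) 1 +
    ∑ i ∈ Icc 2 (p - 1 + s), C (coeffR p s n i k * (p : ℚ) ^ (i - 1) / (1 - i)) *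
      (X * invLin ((p * k : ℕ) : ℚ) 1) ^ (i - 1))

/-- `(X·invLin q 1)′ = (invLin q 1)²` (`d/dX (X/(1+qX)) = (1+qX)^{−2}`). [cite: LaiLupuSprang2025, §3 (3.3)] -/
theorem derivative_X_mul_invLin (q : ℚ) : d⁄dX ℚ (X * invLin q 1) = invLin q 1 ^ 2 := by
  have hu : invLin q 1 * (C (1 : ℚ) + C q * X) = 1 := invLin_mul_lin one_ne_zero
  rw [map_one] at hu
  have hd : d⁄dX ℚ (invLin q 1) = -C q * invLin q 1 ^ 2 := by
    have := derivative_invLin_pow q 1 0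
    simp only [zero_add, pow_one, Nat.cast_zero, mul_one] at this
    exact this
  rw [(d⁄dX ℚ).leibniz, hd, derivative_X, smul_eq_mul, smul_eq_mul, mul_one]
  linear_combination (-(invLin q 1)) * hu

/-- `((X·invLin q 1)^{a+1})′ = (a+1)(X·invLin q 1)^a (invLin q 1)²`. [cite: LaiLupuSprang2025, §3 (3.3)] -/
theorem derivative_X_mul_invLin_pow (q : ℚ) (a : ℕ) :
    d⁄dX ℚ ((X * invLin q 1) ^ (a + 1)) = ((a + 1 : ℕ) : ℚ⟦X⟧) * (X * invLin q 1) ^ a * invLin q 1 ^ 2 := by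
  rw [(d⁄dX ℚ).leibniz_pow, Nat.add_sub_cancel, derivative_X_mul_invLin, smul_eq_mul, nsmul_eq_mul, mul_assoc]

/-- **`X²·(infPrim)′ = −p^{−1}·infSer`** (`d/dt = −X² d/dX` for `X = 1/t` and `dR̃_n/dt = R_n`, at `t/p`; the linear terms
use `ρ_1 = Σ_k r_{1,k} = 0`). [cite: LaiLupuSprang2025, §3 (3.3), Lemma 4.1 (i) and Lemma 6.2 ("We can now compute R̃_n(t/p)")] -/
theorem X_sq_mul_derivative_infPrim {p : ℕ} (hpr : p.Prime) (s n : ℕ) (hs : 1 ≤ s)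
    (hdeg2 : M0 p s + (p - 1) * n + 2 ≤ (p - 1 + s) * (n + 1)) :
    X ^ 2 * d⁄dX ℚ (infPrim p s n) = -C ((p : ℚ)⁻¹) * infSer p s n := by
  have hp : 1 ≤ p := hpr.one_lt.le
  have hp0 : (p : ℚ) ≠ 0 := by exact_mod_cast hpr.ne_zero
  have hρ : ∑ k ∈ range (n + 1), coeffR p s n 1 k = 0 := rho_one_eq_zero hp s n hdeg2
  rw [← sub_eq_zero, neg_mul, sub_neg_eq_add]
  -- both sides as sums over `k`
  have hIcc : Icc 1 (p - 1 + s) = insert 1 (Icc 2 (p - 1 + s)) :=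
    (Finset.insert_Icc_add_one_left_eq_Icc (by omega : 1 ≤ p - 1 + s)).symm
  have h1 : (1 : ℕ) ∉ Icc 2 (p - 1 + s) := by simp
  calc X ^ 2 * d⁄dX ℚ (infPrim p s n) + C ((p : ℚ)⁻¹) * infSer p s n
      = ∑ k ∈ range (n + 1), C (coeffR p s n 1 k) * X := by
        rw [infSer_eq_sum, infPrim, map_sum, mul_sum, mul_sum, ← sum_add_distrib]
        refine sum_congr rfl fun k _ => ?_
        set u := invLin ((p * k : ℕ) : ℚ) 1 with hu_def
        have hu : u * (1 + C ((p * k : ℕ) : ℚ) * X) = 1 := by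
          have := invLin_mul_lin (q := ((p * k : ℕ) : ℚ)) (one_ne_zero (α := ℚ))
          rwa [map_one] at this
        rw [hIcc, sum_insert h1, map_add, map_sum, derivative_C_mul, derivative_logSer, pow_one, pow_one, mul_add, mul_add,
          mul_sum, mul_sum]
        -- the terms with `i ≥ 2` cancel pairwise
        have hcancel : ∀ i ∈ Icc 2 (p - 1 + s),
            X ^ 2 * d⁄dX ℚ (C (coeffR p s n i k * (p : ℚ) ^ (i - 1) / (1 - i)) * (X * u) ^ (i - 1)) +
              C ((p : ℚ)⁻¹) * (C (coeffR p s n i k * (p : ℚ) ^ i) * (X ^ i * u ^ i)) = 0 := by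
          intro i hi
          have hi2 : 2 ≤ i := (mem_Icc.1 hi).1
          obtain ⟨a, rfl⟩ : ∃ a, i = a + 2 := ⟨i - 2, by omega⟩
          rw [show a + 2 - 1 = a + 1 by omega, derivative_C_mul, derivative_X_mul_invLin_pow]
          have hsc : C (coeffR p s n (a + 2) k * (p : ℚ) ^ (a + 1) / (1 - ((a + 2 : ℕ) : ℚ))) * ((a + 1 : ℕ) : ℚ⟦X⟧) +
              C ((p : ℚ)⁻¹) * C (coeffR p s n (a + 2) k * (p : ℚ) ^ (a + 2)) = 0 := by
            rw [← map_natCast (C : ℚ →+* ℚ⟦X⟧), ← map_mul, ← map_mul, ← map_add]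
            have : (1 : ℚ) - ((a + 2 : ℕ) : ℚ) ≠ 0 := by push_cast; linarith [(Nat.cast_nonneg a : (0 : ℚ) ≤ a)]
            rw [show coeffR p s n (a + 2) k * (p : ℚ) ^ (a + 1) / (1 - ((a + 2 : ℕ) : ℚ)) * ((a + 1 : ℕ) : ℚ) +
                (p : ℚ)⁻¹ * (coeffR p s n (a + 2) k * (p : ℚ) ^ (a + 2)) = 0 by
              field_simp; push_cast; ring, map_zero]
          linear_combination (X ^ (a + 2) * u ^ (a + 2)) * hsc
        have hsum0 : (∑ i ∈ Icc 2 (p - 1 + s),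
            X ^ 2 * d⁄dX ℚ (C (coeffR p s n i k * (p : ℚ) ^ (i - 1) / (1 - i)) * (X * u) ^ (i - 1))) +
            ∑ i ∈ Icc 2 (p - 1 + s), C ((p : ℚ)⁻¹) * (C (coeffR p s n i k * (p : ℚ) ^ i) * (X ^ i * u ^ i)) = 0 := by
          rw [← sum_add_distrib]; exact sum_eq_zero hcancel
        -- the linear terms: `r_{1,k}(pk X² u + X u) = r_{1,k} X (u(1 + pkX)) = r_{1,k} X`
        have hsc1 : C ((p : ℚ)⁻¹) * C (coeffR p s n 1 k * (p : ℚ)) = C (coeffR p s n 1 k) := by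
          rw [← map_mul]; congr 1; field_simp
        linear_combination (C (coeffR p s n 1 k) * X) * hu + (X * u) * hsc1 + hsum0
    _ = 0 := by rw [← sum_mul, ← map_sum, hρ, map_zero, zero_mul]

/-- `infPrim` has no constant term. [cite: LaiLupuSprang2025, Lemma 6.2 (the series Σ_k (h_k/(1−k)) t^{−(k−1)} starts at k ≥ 2)] -/
theorem coeff_zero_infPrim (p s n : ℕ) : coeff 0 (infPrim p s n) = 0 := by
  rw [infPrim, map_sum]
  refine sum_eq_zero fun k _ => ?_
  rw [map_add, coeff_C_mul, coeff_logSer_zero, mul_zero, zero_add, map_sum]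
  refine sum_eq_zero fun i hi => ?_
  have hi2 : 2 ≤ i := (mem_Icc.1 hi).1
  obtain ⟨a, rfl⟩ : ∃ a, i = a + 2 := ⟨i - 2, by omega⟩
  rw [coeff_C_mul, show a + 2 - 1 = a + 1 by omega, mul_pow, pow_succ X, coeff_zero_eq_constantCoeff_apply]
  simp

/-- **`K·[X^K] infPrim = −p^{E'−1}·n!^s·h_{K+1}`** (the coefficients `p^{E'−1}n!^s·h_k/(1−k)` of `R̃_n(t/p)`).
[cite: LaiLupuSprang2025, Lemma 6.2 ("R̃_n(t/p) = p^{(p+s)(n+1)−M_0−2} n!^s Σ_k (h_k/(1−k)) t^{−(k−1)}")] -/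
theorem coeff_infPrim_mul {p : ℕ} (hpr : p.Prime) (s n : ℕ) (hs : 1 ≤ s)
    (hdeg2 : M0 p s + (p - 1) * n + 2 ≤ (p - 1 + s) * (n + 1)) (K : ℕ) :
    coeff K (infPrim p s n) * (K : ℚ) =
      -((p : ℚ) ^ (Eexp p s n - 1) * (n ! : ℚ) ^ s) * coeff (K + 1) (hinf p s n) := by
  have hp : 1 ≤ p := hpr.one_lt.le
  have hp0 : (p : ℚ) ≠ 0 := by exact_mod_cast hpr.ne_zero
  have hdeg : M0 p s + (p - 1) * n < (p - 1 + s) * (n + 1) := by omega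
  have hE : 1 ≤ Eexp p s n := by
    have := (Kinf_spec hp hdeg.le).2
    have hK : 1 ≤ Kinf p s n := by
      have := (Kinf_spec hp hdeg.le).1
      have hc : (p - 1 + s) * (n + 1) = (n + 1) * (p - 1 + s) := Nat.mul_comm _ _
      omega
    omega
  have h := congrArg (coeff (K + 1)) (X_sq_mul_derivative_infPrim hpr s n hs hdeg2)
  rw [coeff_X_pow_mul', neg_mul, map_neg, coeff_C_mul, infSer_eq_hinf hp s n hdeg, coeff_C_mul] at h
  rcases K with _ | K
  · have hK2 : 2 ≤ Kinf p s n := by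
      have := (Kinf_spec hp hdeg.le).1
      have hc : (p - 1 + s) * (n + 1) = (n + 1) * (p - 1 + s) := Nat.mul_comm _ _
      omega
    have h1 : coeff 1 (hinf p s n) = 0 := by
      rw [hinf, mul_assoc, coeff_X_pow_mul', if_neg (by omega)]
    simp [h1]
  · rw [if_pos (by omega), show K + 1 + 1 - 2 = K by omega, coeff_derivative] at h
    push_cast
    rw [h]
    obtain ⟨E, hE'⟩ : ∃ E, Eexp p s n = E + 1 := ⟨Eexp p s n - 1, by omega⟩
    rw [hE', Nat.add_sub_cancel, pow_succ]
    field_simp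

/-! ## §4. The analytic bridge at infinity: `R̃_n(j/p) = Σ_K [X^K]infPrim · j^{−K}` in `ℚ_p` -/

section Analytic

variable {p : ℕ} [hpr : Fact p.Prime]

/-- `‖pk/j‖_p < 1` (`p ∤ j`). [cite: LaiLupuSprang2025, Lemma 4.3 (4.5) (|k/x|_p < 1 for x = j/p)] -/
theorem norm_qk_mul_inv_lt_one {j : ℕ} (hj : j ∈ Ico 1 p) (k : ℕ) : ‖(((p * k : ℕ) : ℚ) : ℚ_[p]) * ((j : ℚ_[p]))⁻¹ / ((1 : ℚ) : ℚ_[p])‖ < 1 := by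
  have hj1 : 1 ≤ j := (mem_Ico.1 hj).1
  have hjp : j < p := (mem_Ico.1 hj).2
  have hjd : ¬ p ∣ j := fun h => by have := Nat.le_of_dvd (by omega) h; omega
  have hjn : ‖(j : ℚ_[p])‖ = 1 := by simpa [wq] using norm_wq_eq_one (p := p) hjd 0
  rw [Rat.cast_one, div_one, norm_mul, norm_inv, hjn, inv_one, mul_one]
  push_cast
  rw [norm_mul]
  calc ‖(p : ℚ_[p])‖ * ‖(k : ℚ_[p])‖ ≤ ‖(p : ℚ_[p])‖ * 1 := by
        gcongr; simpa using Padic.norm_int_le_one (p := p) (k : ℤ)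
    _ < 1 := by rw [mul_one]; exact Padic.norm_p_lt_one

/-- **The logarithmic pieces at infinity**: `log_p⟨k + j/p⟩ = log_p(1 + pk/j) = Σ_m [X^m]logSer(pk,1)·j^{−m}`.
[cite: LaiLupuSprang2025, §3 (3.3), Lemma 4.3 (4.5) and Lemma 6.2] -/
theorem hasSum_Lx_natCast {j : ℕ} (hj : j ∈ Ico 1 p) (k : ℕ) :
    HasSum (fun m : ℕ => ((j : ℚ_[p]))⁻¹ ^ m * ((coeff m (logSer ((p * k : ℕ) : ℚ) 1) : ℚ) : ℚ_[p]))
      (Lx (xj p j) ((0 : ℤ_[p]) + k)) := by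
  have hj1 : 1 ≤ j := (mem_Ico.1 hj).1
  have hp0 : (p : ℚ_[p]) ≠ 0 := by exact_mod_cast hpr.out.ne_zero
  have hj0 : (j : ℚ_[p]) ≠ 0 := by exact_mod_cast (show j ≠ 0 by omega)
  have h := hasSum_logSer (p := p) (q := ((p * k : ℕ) : ℚ)) (one_ne_zero (α := ℚ)) (norm_qk_mul_inv_lt_one hj k)
  have e : Lx (xj p j) ((0 : ℤ_[p]) + k) = Transcendental.PadicExp.plog (1 + (((p * k : ℕ) : ℚ) : ℚ_[p]) * ((j : ℚ_[p]))⁻¹ / ((1 : ℚ) : ℚ_[p])) := by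
    simp only [Lx, xj, zero_add, PadicInt.coe_natCast]
    congr 2
    push_cast
    field_simp
  rw [e]
  exact h

/-- Shifting an evaluated expansion by `X^a`: `Σ_M z^M [X^M](X^a F) = z^a Σ_m z^m [X^m]F`. [cite: LaiLupuSprang2025, Lemma 6.2 (the shift t^{−(k−1)})] -/
theorem hasSum_X_pow_mul {F : ℚ⟦X⟧} {z S : ℚ_[p]} (h : HasSum (fun m : ℕ => z ^ m * ((coeff m F : ℚ) : ℚ_[p])) S)
    (a : ℕ) : HasSum (fun M : ℕ => z ^ M * ((coeff M (X ^ a * F) : ℚ) : ℚ_[p])) (z ^ a * S) := by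
  have h0 : ∑ i ∈ range a, z ^ i * ((coeff i (X ^ a * F) : ℚ) : ℚ_[p]) = 0 := by
    refine sum_eq_zero fun i hi => ?_
    rw [coeff_X_pow_mul', if_neg (by have := mem_range.1 hi; omega), Rat.cast_zero, mul_zero]
  have key := (hasSum_nat_add_iff (f := fun M : ℕ => z ^ M * ((coeff M (X ^ a * F) : ℚ) : ℚ_[p])) a
    (g := z ^ a * S))
  rw [h0, add_zero] at key
  rw [← key]
  have e : (fun M : ℕ => z ^ (M + a) * ((coeff (M + a) (X ^ a * F) : ℚ) : ℚ_[p])) =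
      fun M : ℕ => z ^ a * (z ^ M * ((coeff M F : ℚ) : ℚ_[p])) := by
    funext M
    rw [coeff_X_pow_mul, pow_add]
    ring
  rw [e]
  exact h.mul_left _

/-- `k + j/p` raised to `1 − i`: `(k + j/p)^{1−i} = p^{i−1}·j^{−(i−1)}·(1 + pk/j)^{−(i−1)}` (`i = a+2`).
[cite: LaiLupuSprang2025, §3 (3.3) and Lemma 6.2] -/
theorem xj_add_natCast_zpow {j : ℕ} (hj : j ∈ Ico 1 p) (k a : ℕ) :
    (xj p j + k + ((0 : ℤ_[p]) : ℚ_[p])) ^ (1 - ((a + 2 : ℕ) : ℤ)) =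
      (p : ℚ_[p]) ^ (a + 1) * (((j : ℚ_[p]))⁻¹ ^ (a + 1) * ((((1 : ℚ) : ℚ_[p]) + (((p * k : ℕ) : ℚ) : ℚ_[p]) * ((j : ℚ_[p]))⁻¹) ^ (a + 1))⁻¹) := by
  have hj1 : 1 ≤ j := (mem_Ico.1 hj).1
  have hp0 : (p : ℚ_[p]) ≠ 0 := by exact_mod_cast hpr.out.ne_zero
  have hj0 : (j : ℚ_[p]) ≠ 0 := by exact_mod_cast (show j ≠ 0 by omega)
  rw [zpow_one_sub_eq, PadicInt.coe_zero, add_zero, ← inv_pow, ← inv_pow, ← mul_pow, ← mul_pow]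
  congr 1
  rw [xj]
  push_cast
  field_simp

/-- **The power pieces at infinity**: `(k + j/p)^{1−i}·p^{−(i−1)} = Σ_M [X^M](X·invLin(pk,1))^{i−1} · j^{−M}`.
[cite: LaiLupuSprang2025, §3 (3.3) and Lemma 6.2] -/
theorem hasSum_pow_natCast {j : ℕ} (hj : j ∈ Ico 1 p) (k a : ℕ) :
    HasSum (fun M : ℕ => ((j : ℚ_[p]))⁻¹ ^ M * ((coeff M ((X * invLin ((p * k : ℕ) : ℚ) 1) ^ (a + 1)) : ℚ) : ℚ_[p]))
      (((j : ℚ_[p]))⁻¹ ^ (a + 1) * ((((1 : ℚ) : ℚ_[p]) + (((p * k : ℕ) : ℚ) : ℚ_[p]) * ((j : ℚ_[p]))⁻¹) ^ (a + 1))⁻¹) := by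
  have h := hasSum_invLin_pow (p := p) (q := ((p * k : ℕ) : ℚ)) (one_ne_zero (α := ℚ)) (norm_qk_mul_inv_lt_one hj k) a
  have h2 := hasSum_X_pow_mul h (a + 1)
  simpa only [mul_pow] using h2

/-- The pieces of the expansion at infinity (term function). [cite: LaiLupuSprang2025, Lemma 6.2] -/
def infTerm (p : ℕ) [Fact p.Prime] (s n j : ℕ) (M : ℕ) : ℚ_[p] :=
  ∑ k ∈ range (n + 1),
    ((((coeffR p s n 1 k : ℚ) : ℚ_[p]) * (((j : ℚ_[p]))⁻¹ ^ M * ((coeff M (logSer ((p * k : ℕ) : ℚ) 1) : ℚ) : ℚ_[p])) +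
      ∑ i ∈ Icc 2 (p - 1 + s), (((coeffR p s n i k / (1 - i) : ℚ) : ℚ_[p]) * (p : ℚ_[p]) ^ (i - 1)) *
        (((j : ℚ_[p]))⁻¹ ^ M * ((coeff M ((X * invLin ((p * k : ℕ) : ℚ) 1) ^ (i - 1)) : ℚ) : ℚ_[p]))))

/-- The pieces of the expansion at infinity (value). [cite: LaiLupuSprang2025, Lemma 6.2] -/
def infVal (p : ℕ) [Fact p.Prime] (s n j : ℕ) : ℚ_[p] :=
  ∑ k ∈ range (n + 1),
    ((((coeffR p s n 1 k : ℚ) : ℚ_[p]) * Lx (xj p j) ((0 : ℤ_[p]) + k) +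
      ∑ i ∈ Icc 2 (p - 1 + s), (((coeffR p s n i k / (1 - i) : ℚ) : ℚ_[p]) * (p : ℚ_[p]) ^ (i - 1)) *
        (((j : ℚ_[p]))⁻¹ ^ (i - 1) * ((((1 : ℚ) : ℚ_[p]) + (((p * k : ℕ) : ℚ) : ℚ_[p]) * ((j : ℚ_[p]))⁻¹) ^ (i - 1))⁻¹)))

/-- The pieces sum. [cite: LaiLupuSprang2025, Lemma 6.2] -/
theorem hasSum_infTerm {j : ℕ} (hj : j ∈ Ico 1 p) (s n : ℕ) : HasSum (infTerm p s n j) (infVal p s n j) := by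
  unfold infTerm infVal
  refine hasSum_sum fun k _ => ((hasSum_Lx_natCast hj k).mul_left _).add (hasSum_sum fun i hi => ?_)
  have hi2 : 2 ≤ i := (mem_Icc.1 hi).1
  obtain ⟨a, rfl⟩ : ∃ a, i = a + 2 := ⟨i - 2, by omega⟩
  simp only [show a + 2 - 1 = a + 1 by omega]
  exact (hasSum_pow_natCast hj k a).mul_left _

/-- The value is `R̃_n(j/p)`. [cite: LaiLupuSprang2025, Lemma 6.2] -/
theorem infVal_eq {j : ℕ} (hj : j ∈ Ico 1 p) (s n : ℕ) : infVal p s n j = Rtil p s n j 0 := by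
  rw [infVal, Rtil]
  refine sum_congr rfl fun k _ => ?_
  congr 1
  refine sum_congr rfl fun i hi => ?_
  have hi2 : 2 ≤ i := (mem_Icc.1 hi).1
  obtain ⟨a, rfl⟩ : ∃ a, i = a + 2 := ⟨i - 2, by omega⟩
  rw [xj_add_natCast_zpow hj, show a + 2 - 1 = a + 1 by omega]
  ring

/-- The terms are `[X^M] infPrim · j^{−M}`. [cite: LaiLupuSprang2025, Lemma 6.2] -/
theorem infTerm_eq (s n j : ℕ) (M : ℕ) :
    infTerm p s n j M = ((j : ℚ_[p]))⁻¹ ^ M * ((coeff M (infPrim p s n) : ℚ) : ℚ_[p]) := by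
  rw [infTerm, infPrim, map_sum, Rat.cast_sum, mul_sum]
  refine sum_congr rfl fun k _ => ?_
  rw [map_add, coeff_C_mul, map_sum, Rat.cast_add, Rat.cast_mul, Rat.cast_sum, mul_add, mul_sum]
  congr 1
  · ring
  · refine sum_congr rfl fun i _ => ?_
    rw [coeff_C_mul, Rat.cast_mul]
    push_cast
    ring

/-- **The analytic bridge at infinity: `R̃_n(j/p) = Σ_M [X^M]infPrim · j^{−M}` in `ℚ_p`** (`1 ≤ j < p`).
[cite: LaiLupuSprang2025, Lemma 6.2 ("R̃_n(t/p) = p^{(p+s)(n+1)−M_0−2} n!^s Σ_k (h_k/(1−k)) t^{−(k−1)}" at t = j)] -/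
theorem hasSum_infPrim {j : ℕ} (hj : j ∈ Ico 1 p) (s n : ℕ) :
    HasSum (fun M : ℕ => ((j : ℚ_[p]))⁻¹ ^ M * ((coeff M (infPrim p s n) : ℚ) : ℚ_[p])) (Rtil p s n j 0) := by
  have h := hasSum_infTerm hj s n
  rw [infVal_eq hj, show infTerm p s n j = fun M => ((j : ℚ_[p]))⁻¹ ^ M * ((coeff M (infPrim p s n) : ℚ) : ℚ_[p])
    from funext (infTerm_eq s n j)] at h
  exact h

end Analytic

/-! ## §5. Along `n = n(N)`: the coefficients of `(1 − X^{p−1})^n`, (eq:cong_hk1)–(eq:cong_hk2), and the unique dominant term -/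

/-- The coefficients of `G_n = (1 − X^d)^n` (`d ≥ 1`): zero beyond degree `dn`, `(−1)^n` at `dn`, zero off the multiples of `d`.
[cite: LaiLupuSprang2025, Lemma 6.2 (eq:congP)–(eq:cong_hk2) ("h_k ≡ 0 mod p for k ≢ 1 mod (p−1)", "h ≡ 1 mod p")] -/
theorem coeff_oneSubXPow {d : ℕ} (hd : 1 ≤ d) (n : ℕ) :
    (∀ a, d * n < a → coeff a ((1 - X ^ d) ^ n : ℚ⟦X⟧) = 0) ∧ coeff (d * n) ((1 - X ^ d) ^ n : ℚ⟦X⟧) = (-1) ^ n ∧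
      (∀ a, ¬ d ∣ a → coeff a ((1 - X ^ d) ^ n : ℚ⟦X⟧) = 0) := by
  induction n with
  | zero =>
    refine ⟨fun a ha => ?_, by simp, fun a ha => ?_⟩
    · rw [pow_zero, coeff_one, if_neg (by omega)]
    · rw [pow_zero, coeff_one, if_neg (by rintro rfl; exact ha (dvd_zero d))]
  | succ n ih =>
    obtain ⟨h1, h2, h3⟩ := ih
    have hstep : ∀ a, coeff a ((1 - X ^ d) ^ (n + 1) : ℚ⟦X⟧) =
        coeff a ((1 - X ^ d) ^ n : ℚ⟦X⟧) - if d ≤ a then coeff (a - d) ((1 - X ^ d) ^ n : ℚ⟦X⟧) else 0 := by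
      intro a
      rw [pow_succ, mul_sub, mul_one, map_sub, coeff_mul_X_pow']
    refine ⟨fun a ha => ?_, ?_, fun a ha => ?_⟩
    · rw [hstep, h1 a (by nlinarith), if_pos (by nlinarith), h1 (a - d) (by
        have : d * (n + 1) = d * n + d := by ring
        omega), sub_zero]
    · rw [hstep, h1 _ (by nlinarith), if_pos (by nlinarith), show d * (n + 1) - d = d * n by
        rw [Nat.mul_succ, Nat.add_sub_cancel], h2, pow_succ]
      ring
    · rw [hstep, h3 a ha]
      split_ifs with hda
      · rw [h3 (a - d) (fun h => ha ?_), sub_zero]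
        have := Nat.dvd_add h (dvd_refl d)
        rwa [Nat.sub_add_cancel hda] at this
      · rw [sub_zero]

section AlongN

variable {p : ℕ} [hpr : Fact p.Prime]

omit hpr in
/-- Bookkeeping along `n = n(N)`: `Kinf + (p−1)n = p^N(p−1) + 1` («`(n(N)+1)(p−1+s) − M₀ = p^N(p−1)+1`») and `Kinf ≥ 2`.
[cite: LaiLupuSprang2025, §6 ("The key point of the above definitions is that (n(N)+1)(p−1+s)−M_0 = p^N(p−1)+1")] -/
theorem kstar_eq {s n N : ℕ} (hn : (n + 1) * (p - 1 + s) = p ^ N * (p - 1) + 1 + M0 p s)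
    (hdeg2 : M0 p s + (p - 1) * n + 2 ≤ (p - 1 + s) * (n + 1)) :
    Kinf p s n + (p - 1) * n = p ^ N * (p - 1) + 1 ∧ 2 ≤ Kinf p s n := by
  have hc : (p - 1 + s) * (n + 1) = (n + 1) * (p - 1 + s) := Nat.mul_comm _ _
  unfold Kinf
  omega

/-- **(eq:cong_hk2): `h_{p^N(p−1)+1}` is a `p`-adic unit** (`≡ [X^{(p−1)n}](1−X^{p−1})^n = (−1)^n (mod p)`).
[cite: LaiLupuSprang2025, Lemma 6.2 (eq:cong_hk2) ("h_{p^N(p−1)+1} ≡ 1 mod p")] -/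
theorem norm_coeff_hinf_kstar {s n N : ℕ} (hn : (n + 1) * (p - 1 + s) = p ^ N * (p - 1) + 1 + M0 p s)
    (hdeg2 : M0 p s + (p - 1) * n + 2 ≤ (p - 1 + s) * (n + 1)) :
    ‖((coeff (p ^ N * (p - 1) + 1) (hinf p s n) : ℚ) : ℚ_[p])‖ = 1 := by
  have hp2 : 2 ≤ p := hpr.out.two_le
  obtain ⟨hk, hK2⟩ := kstar_eq hn hdeg2
  obtain ⟨-, hG2, -⟩ := coeff_oneSubXPow (d := p - 1) (by omega) n
  -- the congruence `h_{k*} ≡ (−1)^n`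
  have hcong : PadicOrdGe p 1 (coeff (p ^ N * (p - 1) + 1) (hinf p s n) - (-1) ^ n) := by
    have h := psOrdGe_hinf_sub p s n (p ^ N * (p - 1) + 1)
    rwa [map_sub, coeff_X_pow_mul', if_pos (by omega), show p ^ N * (p - 1) + 1 - Kinf p s n = (p - 1) * n by omega,
      hG2] at h
  have hint : PadicOrdGe p 0 (coeff (p ^ N * (p - 1) + 1) (hinf p s n)) := psOrdGe_hinf p s n _
  have hsmall : ‖(((coeff (p ^ N * (p - 1) + 1) (hinf p s n) - (-1) ^ n : ℚ)) : ℚ_[p])‖ < 1 :=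
    lt_of_le_of_lt (norm_ratCast_le_of_padicOrdGe hcong) (by
      rw [zpow_neg, zpow_one]; exact inv_lt_one_of_one_lt₀ (by exact_mod_cast hpr.out.one_lt))
  have hunit : ‖((((-1 : ℚ) ^ n : ℚ)) : ℚ_[p])‖ = 1 := by push_cast; simp
  have e : ((coeff (p ^ N * (p - 1) + 1) (hinf p s n) : ℚ) : ℚ_[p]) =
      ((((-1 : ℚ) ^ n : ℚ)) : ℚ_[p]) + (((coeff (p ^ N * (p - 1) + 1) (hinf p s n) - (-1) ^ n : ℚ)) : ℚ_[p]) := by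
    push_cast; ring
  rw [e, IsUltrametricDist.norm_add_eq_max_of_norm_ne_norm (by rw [hunit]; exact (ne_of_lt hsmall).symm), hunit,
    max_eq_left hsmall.le]

omit hpr in
/-- `(p−1) ∤ a` for the intermediate indices: if `a + p^N(p−1−u) = (p−1)n` with `1 ≤ u ≤ p−2` then `a ≡ u (mod p−1)`.
[cite: LaiLupuSprang2025, Lemma 6.2 ("k = (p−1)p^N+1 is the only integer … which is ≡ 1 mod p^N and ≡ 1 mod (p−1)")] -/
theorem not_dvd_of_intermediate {a u n N : ℕ} (hp2 : 2 ≤ p) (hu1 : 1 ≤ u) (hu2 : u + 2 ≤ p)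
    (ha : a + p ^ N * (p - 1 - u) = (p - 1) * n) : ¬ (p - 1) ∣ a := by
  intro hda
  obtain ⟨q, rfl⟩ : ∃ q, p = q + 1 := ⟨p - 1, by omega⟩
  simp only [Nat.add_sub_cancel] at ha hda
  -- `p^N ≡ 1 (mod q)`
  have hpow : (q : ℤ) ∣ ((q + 1 : ℕ) : ℤ) ^ N - 1 := by
    have := sub_dvd_pow_sub_pow (((q + 1 : ℕ) : ℤ)) 1 N
    push_cast at this ⊢
    simpa using this
  have h1 : (q : ℤ) ∣ (a : ℤ) + ((q + 1 : ℕ) : ℤ) ^ N * ((q - u : ℕ) : ℤ) := by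
    have : ((a + (q + 1) ^ N * (q - u) : ℕ) : ℤ) = ((q * n : ℕ) : ℤ) := by exact_mod_cast ha
    push_cast at this ⊢
    rw [this]
    exact dvd_mul_right _ _
  -- hence `q ∣ (q − u)`, i.e. `q ∣ u`: impossible
  have h2 : (q : ℤ) ∣ ((q - u : ℕ) : ℤ) := by
    have e : ((q - u : ℕ) : ℤ) = ((a : ℤ) + ((q + 1 : ℕ) : ℤ) ^ N * ((q - u : ℕ) : ℤ)) - (a : ℤ) -
        (((q + 1 : ℕ) : ℤ) ^ N - 1) * ((q - u : ℕ) : ℤ) := by ring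
    rw [e]
    exact ((h1.sub (by exact_mod_cast hda)).sub (hpow.mul_right _))
  have h3 : q ∣ q - u := by exact_mod_cast h2
  have := Nat.le_of_dvd (by omega) h3
  omega

/-- **(eq:cong_hk1) and (eq:vphk) combined: for `K ≥ 1`, `K ≠ p^N(p−1)`: `‖h_{K+1}‖_p ≤ p^{N−1}·‖K‖_p`**
(i.e. `v_p(h_k/(1−k)) > −N` for `k ≠ p^N(p−1)+1`). [cite: LaiLupuSprang2025, Lemma 6.2 ("v_p(h_k/(1−k)) > −N for k ≠ p^N(p−1)+1")] -/
theorem norm_coeff_hinf_le {s n N : ℕ} (hN : 1 ≤ N) (hn : (n + 1) * (p - 1 + s) = p ^ N * (p - 1) + 1 + M0 p s)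
    (hdeg2 : M0 p s + (p - 1) * n + 2 ≤ (p - 1 + s) * (n + 1)) {K : ℕ} (hK1 : 1 ≤ K) (hK : K ≠ p ^ N * (p - 1)) :
    ‖((coeff (K + 1) (hinf p s n) : ℚ) : ℚ_[p])‖ ≤ (p : ℝ) ^ ((N : ℤ) - 1) * ‖(K : ℚ_[p])‖ := by
  have hp2 : 2 ≤ p := hpr.out.two_le
  have hp1 : (1 : ℝ) < p := by exact_mod_cast hpr.out.one_lt
  have hp0 : (0 : ℝ) < p := by positivity
  obtain ⟨hk, hK2⟩ := kstar_eq hn hdeg2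
  have hKnorm : ‖(K : ℚ_[p])‖ = (p : ℝ) ^ (-(padicValNat p K : ℤ)) := by
    have e : ((K : ℚ) : ℚ_[p]) = (K : ℚ_[p]) := by push_cast; rfl
    rw [← e, Padic.eq_padicNorm, padicNorm.eq_zpow_of_nonzero (by exact_mod_cast (show K ≠ 0 by omega)),
      padicValRat.of_nat]
    push_cast
    rfl
  have hint : ‖((coeff (K + 1) (hinf p s n) : ℚ) : ℚ_[p])‖ ≤ 1 := by
    simpa using norm_ratCast_le_of_padicOrdGe (psOrdGe_hinf p s n (K + 1))
  rcases Nat.lt_or_gt_of_ne hK with hlt | hgt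
  · -- `K < p^N(p−1)`: `v_p(K) ≤ N`, and `= N` forces `h_{K+1} ≡ 0`
    have hKlt : K < p ^ (N + 1) := by
      calc K < p ^ N * (p - 1) := hlt
        _ < p ^ N * p := Nat.mul_lt_mul_of_pos_left (by omega) (by positivity)
        _ = p ^ (N + 1) := (pow_succ p N).symm
    have hvN : padicValNat p K ≤ N := by
      by_contra h
      have : p ^ (N + 1) ∣ K := (pow_dvd_pow p (by omega)).trans pow_padicValNat_dvd
      exact absurd (Nat.le_of_dvd (by omega) this) (by omega)
    rcases Nat.lt_or_eq_of_le hvN with hv | hv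
    · -- `v_p(K) ≤ N − 1`
      calc ‖((coeff (K + 1) (hinf p s n) : ℚ) : ℚ_[p])‖ ≤ 1 := hint
        _ ≤ (p : ℝ) ^ ((N : ℤ) - 1) * ‖(K : ℚ_[p])‖ := by
            rw [hKnorm, ← zpow_add₀ hp0.ne']
            exact one_le_zpow₀ hp1.le (by omega)
    · -- `v_p(K) = N`: `K = p^N u`, `1 ≤ u ≤ p − 2`, and `(p−1) ∤ (K+1−Kinf)`
      obtain ⟨u, hu⟩ : p ^ N ∣ K := hv ▸ pow_padicValNat_dvd
      have hu1 : 1 ≤ u := by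
        rcases u with _ | u
        · simp at hu; omega
        · omega
      have hu2 : u + 2 ≤ p := by
        by_contra h
        have : p ^ N * (p - 1) ≤ p ^ N * u := Nat.mul_le_mul_left _ (by omega)
        omega
      have hzero : coeff (K + 1) (X ^ Kinf p s n * (1 - X ^ (p - 1)) ^ n : ℚ⟦X⟧) = 0 := by
        rw [coeff_X_pow_mul']
        split_ifs with hle
        · obtain ⟨-, -, hG3⟩ := coeff_oneSubXPow (d := p - 1) (by omega) n
          refine hG3 _ (not_dvd_of_intermediate (u := u) (n := n) (N := N) hp2 hu1 hu2 ?_)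
          have e1 : K + 1 - Kinf p s n + Kinf p s n = p ^ N * u + 1 := by rw [Nat.sub_add_cancel hle, hu]
          have e2 : p ^ N * (p - 1 - u) + p ^ N * u = p ^ N * (p - 1) := by
            rw [← Nat.mul_add]; congr 1; omega
          omega
        · rfl
      have hord : PadicOrdGe p 1 (coeff (K + 1) (hinf p s n)) := by
        have h := psOrdGe_hinf_sub p s n (K + 1)
        rwa [map_sub, hzero, sub_zero] at h
      calc ‖((coeff (K + 1) (hinf p s n) : ℚ) : ℚ_[p])‖ ≤ (p : ℝ) ^ (-(1 : ℤ)) := norm_ratCast_le_of_padicOrdGe hord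
        _ = (p : ℝ) ^ ((N : ℤ) - 1) * ‖(K : ℚ_[p])‖ := by
            rw [hKnorm, ← zpow_add₀ hp0.ne', hv]; congr 1; ring
  · -- `K > p^N(p−1)`: `v_p(h_{K+1}) ≥ K − p^N(p−1)` and `v_p(K) < N + (K − p^N(p−1))`
    have hv := padicValNat_lt_of_lt (p := p) hN hgt
    have hord : PadicOrdGe p ((K + 1 : ℕ) - (Kinf p s n + (p - 1) * n : ℕ) : ℤ) (coeff (K + 1) (hinf p s n)) :=
      padicOrdGe_coeff_hinf p s n (K + 1)
    rw [hk] at hord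
    set P0 : ℕ := p ^ N * (p - 1) with hP0
    have hv' : ((padicValNat p K : ℕ) : ℤ) < N + ((K - P0 : ℕ) : ℤ) := by exact_mod_cast hv
    have hsub : ((K - P0 : ℕ) : ℤ) = (K : ℤ) - (P0 : ℤ) := Nat.cast_sub hgt.le
    calc ‖((coeff (K + 1) (hinf p s n) : ℚ) : ℚ_[p])‖
        ≤ (p : ℝ) ^ (-(((K + 1 : ℕ) : ℤ) - ((P0 + 1 : ℕ) : ℤ))) := norm_ratCast_le_of_padicOrdGe hord
      _ ≤ (p : ℝ) ^ ((N : ℤ) - 1) * ‖(K : ℚ_[p])‖ := by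
          rw [hKnorm, ← zpow_add₀ hp0.ne']
          refine zpow_le_zpow_right₀ hp1.le ?_
          simp only [Nat.cast_add, Nat.cast_one]
          omega

/-! ### The coefficients `v_K = [X^K]infPrim` of `R̃_n(j/p)` and the sum over `j` -/

/-- `‖m‖_p = p^{−v_p(m)}` for `m ≥ 1`. [cite: LaiLupuSprang2025, §6 (|·|_p = p^{−v_p(·)})] -/
private theorem norm_natCast_eq_zpow {m : ℕ} (hm : m ≠ 0) : ‖(m : ℚ_[p])‖ = (p : ℝ) ^ (-(padicValNat p m : ℤ)) := by
  have e : ((m : ℚ) : ℚ_[p]) = (m : ℚ_[p]) := by push_cast; rfl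
  rw [← e, Padic.eq_padicNorm, padicNorm.eq_zpow_of_nonzero (by exact_mod_cast hm), padicValRat.of_nat]
  push_cast
  rfl

/-- The coefficients `v_K := [X^K] infPrim ∈ ℚ ⊂ ℚ_p` of the expansion of `R̃_n(j/p)` in `1/j`.
[cite: LaiLupuSprang2025, Lemma 6.2 (the coefficients p^{…}n!^s h_k/(1−k))] -/
def infCoeff (p : ℕ) [Fact p.Prime] (s n K : ℕ) : ℚ_[p] := ((coeff K (infPrim p s n) : ℚ) : ℚ_[p])

/-- `σ_K := Σ_{j=1}^{p−1} j^{−K}` in `ℚ_p`. [cite: LaiLupuSprang2025, Lemma 6.2 (last display: Σ_j j^{−p^N(p−1)})] -/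
def sigmaK (p : ℕ) [Fact p.Prime] (K : ℕ) : ℚ_[p] := ∑ j ∈ Ico 1 p, ((j : ℚ_[p]))⁻¹ ^ K

/-- `‖σ_K‖_p ≤ 1`. [cite: LaiLupuSprang2025, Lemma 6.2 (last display)] -/
theorem norm_sigmaK_le_one (K : ℕ) : ‖sigmaK p K‖ ≤ 1 := by
  refine IsUltrametricDist.norm_sum_le_of_forall_le_of_nonneg zero_le_one fun j hj => ?_
  rw [norm_pow, norm_inv]
  have : ‖(j : ℚ_[p])‖ ≤ 1 := by simpa using Padic.norm_int_le_one (p := p) (j : ℤ)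
  have hj0 : (j : ℚ_[p]) ≠ 0 := by exact_mod_cast (show j ≠ 0 by have := (mem_Ico.1 hj).1; omega)
  have hjd : ¬ p ∣ j := fun h => by
    have := Nat.le_of_dvd (by have := (mem_Ico.1 hj).1; omega) h; have := (mem_Ico.1 hj).2; omega
  have h1 : ‖(j : ℚ_[p])‖ = 1 := by simpa [wq] using norm_wq_eq_one (p := p) hjd 0
  rw [h1, inv_one, one_pow]

/-- **`‖σ_{p^N(p−1)}‖_p = 1`** (Fermat: `j^{−p^N(p−1)} ≡ 1`, and `p − 1 ≢ 0 (mod p)`).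
[cite: LaiLupuSprang2025, Lemma 6.2 (last display: "Σ_{j=1}^{p−1} 1 ≢ 0")] -/
theorem norm_sigmaK_kstar (N : ℕ) : ‖sigmaK p (p ^ N * (p - 1))‖ = 1 := by
  have h := norm_sum_zpow_neg_eq_one (p := p) N
  rw [sigmaK]
  simpa only [inv_pow] using h

/-- **`Σ_{j=1}^{p−1} R̃_n(j/p) = Σ_K v_K σ_K`** (summing the analytic bridge over `j`). [cite: LaiLupuSprang2025, Lemma 6.2 (last display)] -/
theorem hasSum_sum_Rtil_zero (s n : ℕ) :
    HasSum (fun K : ℕ => infCoeff p s n K * sigmaK p K) (∑ j ∈ Ico 1 p, Rtil p s n j 0) := by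
  have h := hasSum_sum (s := Ico 1 p) fun j hj => hasSum_infPrim (p := p) hj s n
  refine h.congr_fun fun K => ?_
  rw [infCoeff, sigmaK, mul_sum]
  refine sum_congr rfl fun j _ => ?_
  ring

/-- `v_0 = 0`. [cite: LaiLupuSprang2025, Lemma 6.2] -/
theorem infCoeff_zero (s n : ℕ) : infCoeff p s n 0 = 0 := by
  rw [infCoeff, coeff_zero_infPrim, Rat.cast_zero]

/-- `v_K = −p^{E'−1}n!^s·h_{K+1}/K` for `K ≥ 1`. [cite: LaiLupuSprang2025, Lemma 6.2 ("Σ_k (h_k/(1−k)) t^{−(k−1)}")] -/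
theorem infCoeff_eq (s n : ℕ) (hs : 1 ≤ s) (hdeg2 : M0 p s + (p - 1) * n + 2 ≤ (p - 1 + s) * (n + 1)) {K : ℕ}
    (hK : K ≠ 0) : infCoeff p s n K = -((((p : ℚ) ^ (Eexp p s n - 1) * (n ! : ℚ) ^ s : ℚ)) : ℚ_[p]) *
      ((coeff (K + 1) (hinf p s n) : ℚ) : ℚ_[p]) / (K : ℚ_[p]) := by
  have h := coeff_infPrim_mul hpr.out s n hs hdeg2 K
  have hK' : (K : ℚ) ≠ 0 := by exact_mod_cast hK
  have e : coeff K (infPrim p s n) = -((p : ℚ) ^ (Eexp p s n - 1) * (n ! : ℚ) ^ s) *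
      coeff (K + 1) (hinf p s n) / (K : ℚ) := by
    rw [eq_div_iff hK', h]
  rw [infCoeff, e]
  push_cast
  ring

/-- `‖p^{E'−1} n!^s‖_p = p^{−(E'−1)}·p^{−s·v_p(n!)}`. [cite: LaiLupuSprang2025, Lemma 6.2] -/
theorem norm_infConst (s n : ℕ) :
    ‖((((p : ℚ) ^ (Eexp p s n - 1) * (n ! : ℚ) ^ s : ℚ)) : ℚ_[p])‖ =
      (p : ℝ) ^ (-((Eexp p s n - 1 : ℕ) : ℤ)) * (p : ℝ) ^ (-((s * padicValNat p (n !) : ℕ) : ℤ)) := by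
  have hp0 : (0 : ℝ) < p := by exact_mod_cast hpr.out.pos
  have e : ((((p : ℚ) ^ (Eexp p s n - 1) * (n ! : ℚ) ^ s : ℚ)) : ℚ_[p]) =
      (p : ℚ_[p]) ^ (Eexp p s n - 1) * ((n ! : ℕ) : ℚ_[p]) ^ s := by push_cast; ring
  rw [e, norm_mul, norm_pow, norm_pow, Padic.norm_p, norm_natCast_eq_zpow (Nat.factorial_ne_zero n), ← zpow_natCast,
    ← zpow_natCast, ← zpow_mul, inv_zpow']
  congr 2
  simp only [Nat.cast_mul]
  ring

/-- **The dominant coefficient: `‖v_{p^N(p−1)}‖_p = p^N·p^{−(E'−1)}·p^{−s v_p(n!)}`** (`v_p = −N` relative to the constant).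
[cite: LaiLupuSprang2025, Lemma 6.2 ("= −N for k = p^N(p−1)+1")] -/
theorem norm_infCoeff_kstar {s n N : ℕ} (hs : 1 ≤ s)
    (hn : (n + 1) * (p - 1 + s) = p ^ N * (p - 1) + 1 + M0 p s)
    (hdeg2 : M0 p s + (p - 1) * n + 2 ≤ (p - 1 + s) * (n + 1)) :
    ‖infCoeff p s n (p ^ N * (p - 1))‖ = (p : ℝ) ^ (N : ℤ) *
      ((p : ℝ) ^ (-((Eexp p s n - 1 : ℕ) : ℤ)) * (p : ℝ) ^ (-((s * padicValNat p (n !) : ℕ) : ℤ))) := by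
  have hp2 : 2 ≤ p := hpr.out.two_le
  have hp0 : (0 : ℝ) < p := by exact_mod_cast hpr.out.pos
  have hK0 : p ^ N * (p - 1) ≠ 0 := Nat.mul_ne_zero (pow_ne_zero _ hpr.out.ne_zero) (by omega)
  have hv : padicValNat p (p ^ N * (p - 1)) = N := by
    rw [padicValNat.mul (pow_ne_zero _ hpr.out.ne_zero) (by omega), padicValNat.prime_pow,
      padicValNat.eq_zero_of_not_dvd (fun h => by have := Nat.le_of_dvd (by omega) h; omega), add_zero]
  rw [infCoeff_eq s n hs hdeg2 hK0, norm_div, norm_mul, norm_neg, norm_infConst, norm_coeff_hinf_kstar hn hdeg2,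
    mul_one, norm_natCast_eq_zpow hK0, hv, zpow_neg _ (N : ℤ), div_inv_eq_mul]
  ring

/-- **The other coefficients: `‖v_K‖_p ≤ p^{N−1}·p^{−(E'−1)}·p^{−s v_p(n!)}` for `K ≠ p^N(p−1)`** (`v_p > −N`).
[cite: LaiLupuSprang2025, Lemma 6.2 ("> −N for k ≠ p^N(p−1)+1")] -/
theorem norm_infCoeff_le {s n N : ℕ} (hs : 1 ≤ s) (hN : 1 ≤ N)
    (hn : (n + 1) * (p - 1 + s) = p ^ N * (p - 1) + 1 + M0 p s)
    (hdeg2 : M0 p s + (p - 1) * n + 2 ≤ (p - 1 + s) * (n + 1)) {K : ℕ} (hK : K ≠ p ^ N * (p - 1)) :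
    ‖infCoeff p s n K‖ ≤ (p : ℝ) ^ ((N : ℤ) - 1) *
      ((p : ℝ) ^ (-((Eexp p s n - 1 : ℕ) : ℤ)) * (p : ℝ) ^ (-((s * padicValNat p (n !) : ℕ) : ℤ))) := by
  have hp0 : (0 : ℝ) < p := by exact_mod_cast hpr.out.pos
  rcases Nat.eq_zero_or_pos K with hK0 | hK1
  · subst hK0; rw [infCoeff_zero, norm_zero]; positivity
  have hKn : (K : ℚ_[p]) ≠ 0 := by exact_mod_cast (show K ≠ 0 by omega)
  have hKpos : 0 < ‖(K : ℚ_[p])‖ := norm_pos_iff.2 hKn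
  rw [infCoeff_eq s n hs hdeg2 (by omega), norm_div, norm_mul, norm_neg, norm_infConst, div_le_iff₀ hKpos]
  have h := norm_coeff_hinf_le hN hn hdeg2 hK1 hK
  calc (p : ℝ) ^ (-((Eexp p s n - 1 : ℕ) : ℤ)) * (p : ℝ) ^ (-((s * padicValNat p (n !) : ℕ) : ℤ)) *
        ‖((coeff (K + 1) (hinf p s n) : ℚ) : ℚ_[p])‖
      ≤ (p : ℝ) ^ (-((Eexp p s n - 1 : ℕ) : ℤ)) * (p : ℝ) ^ (-((s * padicValNat p (n !) : ℕ) : ℤ)) *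
        ((p : ℝ) ^ ((N : ℤ) - 1) * ‖(K : ℚ_[p])‖) := by gcongr
    _ = _ := by ring

/-- **Lemma 6.2: `‖Σ_{j=1}^{p−1} R̃_n(j/p)‖_p = p^N·p^{−(E'−1)}·p^{−s·v_p(n!)}`**, i.e.
`v_p(Σ_j R̃_n(j/p)) = (p+s)(n+1) + s·v_p(n!) − M₀ − 2 − N` for `n = n(N)` (the unique dominant term `K = p^N(p−1)`).
[cite: LaiLupuSprang2025, Lemma 6.2] -/
theorem norm_sum_Rtil_zero {s n N : ℕ} (hs : 1 ≤ s) (hN : 1 ≤ N)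
    (hn : (n + 1) * (p - 1 + s) = p ^ N * (p - 1) + 1 + M0 p s)
    (hdeg2 : M0 p s + (p - 1) * n + 2 ≤ (p - 1 + s) * (n + 1)) :
    ‖∑ j ∈ Ico 1 p, Rtil p s n j 0‖ = (p : ℝ) ^ (N : ℤ) *
      ((p : ℝ) ^ (-((Eexp p s n - 1 : ℕ) : ℤ)) * (p : ℝ) ^ (-((s * padicValNat p (n !) : ℕ) : ℤ))) := by
  have hp1 : (1 : ℝ) < p := by exact_mod_cast hpr.out.one_lt
  have hp0 : (0 : ℝ) < p := by positivity
  have hS := hasSum_sum_Rtil_zero (p := p) s n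
  rw [← hS.tsum_eq]
  have hdom : ‖infCoeff p s n (p ^ N * (p - 1)) * sigmaK p (p ^ N * (p - 1))‖ = (p : ℝ) ^ (N : ℤ) *
      ((p : ℝ) ^ (-((Eexp p s n - 1 : ℕ) : ℤ)) * (p : ℝ) ^ (-((s * padicValNat p (n !) : ℕ) : ℤ))) := by
    rw [norm_mul, norm_sigmaK_kstar, mul_one, norm_infCoeff_kstar hs hn hdeg2]
  rw [← hdom]
  refine norm_tsum_eq_of_dominant hS.summable (p ^ N * (p - 1))
    (c := (p : ℝ) ^ ((N : ℤ) - 1) *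
      ((p : ℝ) ^ (-((Eexp p s n - 1 : ℕ) : ℤ)) * (p : ℝ) ^ (-((s * padicValNat p (n !) : ℕ) : ℤ))))
    (by positivity) ?_ fun K hK => ?_
  · rw [hdom]
    exact mul_lt_mul_of_pos_right (zpow_lt_zpow_right₀ hp1 (by omega)) (by positivity)
  · rw [norm_mul]
    calc ‖infCoeff p s n K‖ * ‖sigmaK p K‖ ≤ ‖infCoeff p s n K‖ * 1 := by
          gcongr; exact norm_sigmaK_le_one K
      _ ≤ _ := by rw [mul_one]; exact norm_infCoeff_le hs hN hn hdeg2 hK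

/-! ## §6. Lemma 6.3: `v_p(S_n) = v_p(Σ_j R̃_n(j/p))` and `S_n ≠ 0` -/

/-- `n + 1 < p^{n+N}` (`N ≥ 1`): the Archimedean size of the `𝓛_1`-losses `log_p(n+1)` against the gain `p^n`.
[cite: LaiLupuSprang2025, proof of Lemma 6.3 ("v_p(Σ_j R̃_n(j/p)) < v_p(𝓛_1(R_n(t+j/p)))")] -/
theorem succ_lt_pow_add {p : ℕ} (hp : 2 ≤ p) (n : ℕ) {N : ℕ} (hN : 1 ≤ N) : n + 1 < p ^ (n + N) := by
  calc n + 1 < 2 ^ (n + 1) := Nat.lt_two_pow_self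
    _ ≤ p ^ (n + 1) := Nat.pow_le_pow_left hp _
    _ ≤ p ^ (n + N) := Nat.pow_le_pow_right (by omega) (by omega)

/-- **Lemma 6.3: `‖S_n‖_p = p^N·p^{−(E'−1)}·p^{−s v_p(n!)}`** for `n = n(N)`, `N ≥ 1` — since by Lemma 6.1
`‖S_{j/p} + R̃_n(j/p)‖_p ≤ p(n+1)p^{−(E'+n)−s v_p(n!)} < ‖Σ_j R̃_n(j/p)‖_p` (Lemma 6.2).
[cite: LaiLupuSprang2025, Lemma 6.3] -/
theorem norm_Sn {s n N : ℕ} (hs : 1 ≤ s) (hN : 1 ≤ N)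
    (hn : (n + 1) * (p - 1 + s) = p ^ N * (p - 1) + 1 + M0 p s)
    (hdeg2 : M0 p s + (p - 1) * n + 2 ≤ (p - 1 + s) * (n + 1)) :
    ‖Sn p s n‖ = (p : ℝ) ^ (N : ℤ) *
      ((p : ℝ) ^ (-((Eexp p s n - 1 : ℕ) : ℤ)) * (p : ℝ) ^ (-((s * padicValNat p (n !) : ℕ) : ℤ))) := by
  have hp2 : 2 ≤ p := hpr.out.two_le
  have hp1 : (1 : ℝ) < p := by exact_mod_cast hpr.out.one_lt
  have hp0 : (0 : ℝ) < p := by positivity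
  have hdeg : M0 p s + (p - 1) * n < (p - 1 + s) * (n + 1) := by omega
  have hM : M0 p s ≤ n + (n + 1) * (p - 1 + s) := by
    have hc : (p - 1 + s) * (n + 1) = (n + 1) * (p - 1 + s) := Nat.mul_comm _ _
    omega
  have hE1 : 1 ≤ Eexp p s n := by
    have := (Kinf_spec hpr.out.one_lt.le hdeg.le).2
    have := (kstar_eq hn hdeg2).2
    omega
  -- `S_n = Σ_j (S_j + R̃_n(j/p)) − Σ_j R̃_n(j/p)`
  have e : Sn p s n = (∑ j ∈ Ico 1 p, (Sj p s n j + Rtil p s n j 0)) + -∑ j ∈ Ico 1 p, Rtil p s n j 0 := by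
    rw [Sn, sum_add_distrib]; ring
  -- the perturbation is strictly smaller
  have hB : ‖∑ j ∈ Ico 1 p, (Sj p s n j + Rtil p s n j 0)‖ ≤
      p * (((n : ℝ) + 1) * (p : ℝ) ^ (-((Epole p s n : ℤ) + s * padicValNat p (n !)))) :=
    IsUltrametricDist.norm_sum_le_of_forall_le_of_nonneg (by positivity)
      fun j hj => norm_Sj_add_Rtil_zero_le s n hs hdeg hM hj
  have hA := norm_sum_Rtil_zero hs hN hn hdeg2
  have hlt : p * (((n : ℝ) + 1) * (p : ℝ) ^ (-((Epole p s n : ℤ) + s * padicValNat p (n !)))) <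
      (p : ℝ) ^ (N : ℤ) * ((p : ℝ) ^ (-((Eexp p s n - 1 : ℕ) : ℤ)) * (p : ℝ) ^ (-((s * padicValNat p (n !) : ℕ) : ℤ))) := by
    have hsmall : ((n : ℝ) + 1) < (p : ℝ) ^ ((n + N : ℕ) : ℤ) := by
      rw [zpow_natCast]; exact_mod_cast succ_lt_pow_add hp2 n hN
    have eE : (Epole p s n : ℤ) = (Eexp p s n - 1 : ℕ) + 1 + n := by
      rw [Epole]; push_cast; omega
    -- rewrite both sides as `p^{1−Epole−sv}·(n+1)` and `p^{1−Epole−sv}·p^{n+N}`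
    have lhs_eq : p * (((n : ℝ) + 1) * (p : ℝ) ^ (-((Epole p s n : ℤ) + s * padicValNat p (n !)))) =
        (p : ℝ) ^ (1 - (Epole p s n : ℤ) - s * padicValNat p (n !)) * ((n : ℝ) + 1) := by
      rw [show (1 : ℤ) - (Epole p s n : ℤ) - s * padicValNat p (n !) =
          1 + (-((Epole p s n : ℤ) + s * padicValNat p (n !))) by ring, zpow_add₀ hp0.ne', zpow_one]
      ring
    have rhs_eq : (p : ℝ) ^ (N : ℤ) * ((p : ℝ) ^ (-((Eexp p s n - 1 : ℕ) : ℤ)) *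
        (p : ℝ) ^ (-((s * padicValNat p (n !) : ℕ) : ℤ))) =
        (p : ℝ) ^ (1 - (Epole p s n : ℤ) - s * padicValNat p (n !)) * (p : ℝ) ^ ((n + N : ℕ) : ℤ) := by
      rw [← zpow_add₀ hp0.ne', ← zpow_add₀ hp0.ne', ← zpow_add₀ hp0.ne']
      congr 1
      push_cast
      rw [eE]
      ring
    rw [lhs_eq, rhs_eq]
    exact mul_lt_mul_of_pos_left hsmall (zpow_pos hp0 _)
  have hne : ‖∑ j ∈ Ico 1 p, (Sj p s n j + Rtil p s n j 0)‖ ≠ ‖-∑ j ∈ Ico 1 p, Rtil p s n j 0‖ := by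
    rw [norm_neg, hA]; exact ne_of_lt (lt_of_le_of_lt hB hlt)
  rw [e, IsUltrametricDist.norm_add_eq_max_of_norm_ne_norm hne, norm_neg, hA]
  exact max_eq_right ((hB.trans hlt.le))

/-- **Lemma 6.3, in particular: `S_n ≠ 0`** for `n = n(N)`, `N ≥ 1`. [cite: LaiLupuSprang2025, Lemma 6.3 ("In particular, S_n ≠ 0")] -/
theorem Sn_ne_zero {s n N : ℕ} (hs : 1 ≤ s) (hN : 1 ≤ N)
    (hn : (n + 1) * (p - 1 + s) = p ^ N * (p - 1) + 1 + M0 p s)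
    (hdeg2 : M0 p s + (p - 1) * n + 2 ≤ (p - 1 + s) * (n + 1)) : Sn p s n ≠ 0 := by
  have hp0 : (0 : ℝ) < p := by exact_mod_cast hpr.out.pos
  rw [← norm_pos_iff, norm_Sn hs hN hn hdeg2]
  positivity

end AlongN

end Literature.NumberTheory.Irrationality.LaiLupuSprang2025

end
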